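import Literature.Topology.FourManifolds.GompfFramedSpheres
import Mathlib.AlgebraicTopology.FundamentalGroupoid.FundamentalGroup
import HarnessLib

/-!
# Gompf's Theorem 4.3 along its printed proof: framed Δ-moves, straightening classes and `π₁ GL⁺(3, ℝ)`

Sixth file of the decomposition of the named fact
`Literature.Topology.FourManifolds.nonempty_diffeomorph_sphere_four_of_isCappellShanesonSphereOf` (R. Gompf, *More
Cappell–Shaneson spheres are standard*, Algebr. Geom. Topol. 10 (2010), Examples 3.1(a)).
`GompfFramedSpheres.lean` left Theorem 4.3 as one leaf, `Literature.Topology.FourManifolds.gompf2010_thm43` ("all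
`X^σ_{A₀} = gompfSphere A₀ γ` are diffeomorphic"). Here that leaf is **proved** from the
ingredients of Gompf's proof (§4), each vendored as its own named fact in the source's wording:

* `Literature.Topology.FourManifolds.gompf2010_straightening_invariance` (**W**) — `X^σ_A` depends only on the straightening
  *class* `σ = [γ]` (Def. 4.1: "a straightening … is a homotopy class of paths in `GL(V)`"; §4 ¶2);
* `Literature.Topology.FourManifolds.gompf2010_conj_invariance` (**Cj**) — conjugating `A` and its straightening by
  `C ∈ SL(3, ℤ)` does not change `X^σ_A` (§3 ¶1; proof of Thm 4.3: "Since conjugation preserves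
  linear straightenings, we obtain a diffeomorphism from `X^{σ_A}_A` to `X^{σ_B}_B`");
* `Literature.Topology.FourManifolds.gompf2010_framedTwist` (**F**) and `Literature.Topology.FourManifolds.gompf2010_framedTwistZero` (**F₀**) — the *framed*
  Theorem 2.1 (§4 ¶3 and ¶5): for `B = Δᵏ A`, `A Δᵏ` (resp. `Δ₀ᵏ A`, `A Δ₀ᵏ`),
  "`X^{τ·σ}_B = X^σ_A`" with `τ` the linear path between `B` and `A`;
* `Literature.Topology.FourManifolds.fundamentalGroup_posDetMatrix_three` (**P1**) — `π₁(GL⁺(3, ℝ)) = ℤ/2` (§4, after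
  Def. 4.1: "there are exactly two straightenings of `A`, differing by an element of
  `π₁(GL(V)) = ℤ/2`"; Hatcher, *Algebraic Topology*, §3.D and Example 1.43);
* `Literature.Topology.FourManifolds.gompf2010_framingLoop_essential` (**P2**) — the loop `τ·ρ` through the five matrices of the
  proof of Thm 4.3 is essential in `GL⁺(3, ℝ)` ("nonzero by inspection", loc. cit., last
  paragraph of the proof).

**Proved** here: `GL⁺(n, ℝ)` as the subspace `PosDetMatrix n` of `Mₙ(ℝ)`; smooth matrix paths as
paths in it (`SmoothMatrixPath.toPath`), their concatenation with linear segments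
(`SmoothMatrixPath.concat`, `deltaLeft`, `deltaRight`, `deltaZeroLeft`, `deltaZeroRight` — Gompf's
`τ·σ`) and conjugation (`SmoothMatrixPath.conj`); the identification of these concatenations with
`Path.trans` in the fundamental groupoid; the **2-simplex of linear straightenings** `σ_A, σ_B, ρ`
(`[σ_B] = [σ_A]·[ρ]`, `Literature.Topology.FourManifolds.mk_toPath_gompfSigmaB`, from the determinant positivity proved in
`GompfStraightening.lean` and an end-point-sliding homotopy `Literature.Topology.FourManifolds.homotopic_slide`); the
fundamental-groupoid bookkeeping showing that, given the simplex, `[σ_B] ≠ [τ·σ_A]` follows from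
P2 (`Literature.Topology.FourManifolds.mk_toPath_gompfSigmaB_ne`); the pigeonhole from P1 (any straightening of `B` is `σ_B` or
`τ·σ_A` up to homotopy, `Literature.Topology.FourManifolds.quotient_eq_or_eq_of_card_eq_two`); and hence

* `Literature.gompf2010_thm43_of_framed : W → Cj → F → F₀ → P1 → P2 → gompf2010_thm43`;
* `Literature.gompf2010_deltaMove_of_framedTwist : F → gompf2010_straightening_classification → gompf2010_deltaMove`
  (the Δ-move leaf of `CappellShanesonGompfReduction.lean`, now from the framed twist);
* the assembly `Literature.Topology.FourManifolds.nonempty_diffeomorph_sphere_four_of_isCappellShanesonSphereOf_of_atomic`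
  from the leaf set {`gompf2010_sectionCircle_framings`, W, Cj, F, F₀, P1, P2,
  `akbulutKirby1979_linearStraightening`}.

Conventions (as in `GompfFramedSpheres.lean`): the tree's mapping torus glues
`(x, s) ∼ (A x, s + 1)` (Gompf's `X_{A⁻¹}`) and its framing paths run from `1` to `A`, so Gompf's
`τ·σ` ("first `τ` from `B` to `A`, then `σ` from `A` to `I`") is read backwards: `γ` from `1` to `A`
followed by the segment from `A` to `B`. That this is the correct pairing under the tree's
conventions is recorded in the docstring of `Literature.Topology.FourManifolds.gompf2010_framedTwist`; independently of
conventions, for the five matrices of the chain (traces `4, -2, 0, 2, 4 ∈ [-6, 9]`) *both* spheres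
are `S⁴` in print (loc. cit. Thm 3.2), so every instance of F/F₀ used below is a theorem in print
either way.

## References

* R. E. Gompf, *More Cappell–Shaneson spheres are standard*, Algebr. Geom. Topol. 10 (2010)
  1665–1681, doi:10.2140/agt.2010.10.1665 (arXiv:0908.1914): §3 ¶1–3, §4 (Def. 4.1, ¶2–¶5,
  Prop. 4.2, Thm 4.3 and its proof). [GompfAGT2010]
* R. Gompf, A. Stipsicz, *4-Manifolds and Kirby Calculus*, GSM 20 (1999), §5.2 (surgery on a framed
  circle depends only on the isotopy class of the framing). [GompfStipsiczGSM1999]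
* A. Hatcher, *Algebraic Topology* (2002), §3.D (`GLₙ(ℝ)` deformation retracts onto `O(n)` by
  Gram–Schmidt; `SO(3) ≈ ℝP³`, universal cover `S³ → SO(3)`) and Example 1.43
  (`π₁(ℝPⁿ) = ℤ/2`, `n ≥ 2`). [HatcherAT2002]
-/

open scoped Manifold ContDiff Topology unitInterval
open Set Function Matrix

noncomputable section

namespace Literature.Topology.FourManifolds

universe u

/-! ### `GL⁺(n, ℝ)` as a subspace of `Mₙ(ℝ)` -/

/-- **`GL⁺(n, ℝ)`**, the real `n × n` matrices of positive determinant, as the (open) subspace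
`{M | 0 < det M}` of `Mₙ(ℝ) = ℝ^{n²}` — the topology of the Lie group `GL⁺(n, ℝ)`. Fundamental
groups and homotopy classes of paths of framings are taken in this space (Gompf 2010, Def. 4.1:
"paths in `GL(V)`"). (Mathlib's `Matrix.GLPos (Fin n) ℝ` is the same group as a subgroup of the
units `GL (Fin n) ℝ`, topologised through `Mˣ ↪ M × Mᵐᵒᵖ`; the plain subtype of `Matrix` is used
here because the framing paths of `SectionCircleNbhd.lean` are matrix-valued, so that they become
paths in this space with no conversion; the two topologies agree.) [cite: GompfAGT2010, Def. 4.1] -/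
abbrev PosDetMatrix (n : ℕ) : Type := {M : Matrix (Fin n) (Fin n) ℝ // 0 < M.det}

namespace PosDetMatrix

variable {n : ℕ}

/-- The unit matrix as the distinguished point `1 ∈ GL⁺(n, ℝ)` (base point of the fundamental
group; no `One` instance exists on this subtype). [folklore] -/
instance : One (PosDetMatrix n) := ⟨⟨1, by simp⟩⟩

/-- The unit matrix is the base point of `GL⁺(n, ℝ)`. [folklore] -/
@[simp] theorem coe_one : ((1 : PosDetMatrix n) : Matrix (Fin n) (Fin n) ℝ) = 1 := rfl

end PosDetMatrix

/-- A continuous real function on `[a, b]` without zeros and positive at `a` is positive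
(intermediate value theorem). [folklore] -/
theorem forall_pos_of_forall_ne_zero {f : ℝ → ℝ} {a b : ℝ} (hf : ContinuousOn f (Icc a b))
    (h0 : 0 < f a) (hne : ∀ t ∈ Icc a b, f t ≠ 0) : ∀ t ∈ Icc a b, 0 < f t := by
  intro t ht
  by_contra h
  replace h : f t ≤ 0 := not_lt.1 h
  have hsub : Icc (f t) (f a) ⊆ f '' Icc a t :=
    intermediate_value_Icc' ht.1 (hf.mono (Icc_subset_Icc_right ht.2))
  obtain ⟨c, hc, hfc⟩ := hsub ⟨h, h0.le⟩
  exact hne c ⟨hc.1, hc.2.trans ht.2⟩ hfc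

/-- Along a linearly straightenable matrix the determinant of the segment `t M + (1 - t) I` is
*positive* on `[0, 1]` (it is a unit there and equals `1` at `t = 0`). [cite: GompfAGT2010, Def. 4.1 and Prop. 4.2 (linear straightening)] -/
theorem IsLinearlyStraightenable.det_linearPath_pos {M : Matrix (Fin 3) (Fin 3) ℝ}
    (h : IsLinearlyStraightenable M) : ∀ t ∈ Icc (0 : ℝ) 1, 0 < (linearPath M t).det := by
  refine forall_pos_of_forall_ne_zero ?_ (by simp) fun t ht ↦ (h t ht).ne_zero
  have : Continuous fun t : ℝ ↦ linearPath M t := by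
    unfold linearPath
    fun_prop
  exact this.matrix_det.continuousOn

/-- `t (C M D) + (1 - t) I = C (t M + (1 - t) I) D` for `C D = 1` ("conjugation preserves linear
straightenings", Gompf 2010, proof of Thm 4.3). [cite: GompfAGT2010, Thm 4.3 (proof: conjugation preserves linear straightenings)] -/
theorem linearPath_conj (C M D : Matrix (Fin 3) (Fin 3) ℝ) (hCD : C * D = 1) (t : ℝ) :
    linearPath (C * M * D) t = C * linearPath M t * D := by
  simp only [linearPath, Matrix.mul_add, Matrix.add_mul, Matrix.mul_smul, Matrix.smul_mul,
    Matrix.mul_one, hCD]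

/-- Conjugates of linearly straightenable matrices are linearly straightenable. [cite: GompfAGT2010, Thm 4.3 (proof: conjugation preserves linear straightenings)] -/
theorem IsLinearlyStraightenable.conj {M : Matrix (Fin 3) (Fin 3) ℝ}
    (h : IsLinearlyStraightenable M) (C D : Matrix (Fin 3) (Fin 3) ℝ) (hCD : C * D = 1) :
    IsLinearlyStraightenable (C * M * D) := by
  intro t ht
  rw [linearPath_conj C M D hCD, Matrix.det_mul, Matrix.det_mul, mul_comm (C.det), mul_assoc,
    ← Matrix.det_mul, hCD, Matrix.det_one, mul_one]
  exact h t ht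

/-! ### Smooth matrix paths as paths in `GL⁺(n, ℝ)` -/

namespace SmoothMatrixPath

variable {m : ℕ} {M N P : Matrix (Fin m) (Fin m) ℝ}

/-- The matrices of a smooth matrix path are invertible. [folklore] -/
theorem det_ne_zero (γ : SmoothMatrixPath M) (θ : ℝ) : (γ.toFun θ).det ≠ 0 := by
  intro h
  have := congrArg Matrix.det (γ.mul_inv θ)
  rw [Matrix.det_mul, h, zero_mul, Matrix.det_one] at this
  exact zero_ne_one this

/-- The determinant along a smooth matrix path is continuous. [folklore] -/
theorem continuous_det (γ : SmoothMatrixPath M) : Continuous fun θ ↦ (γ.toFun θ).det :=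
  γ.continuous.matrix_det

/-- **Smooth matrix paths lie in `GL⁺`**: the determinant never vanishes and equals `1` at the
start, so it is positive throughout. [folklore] -/
theorem det_pos (γ : SmoothMatrixPath M) (θ : ℝ) : 0 < (γ.toFun θ).det := by
  have h0 : (γ.toFun 0).det = 1 := by rw [γ.eq_one 0 le_rfl, Matrix.det_one]
  rcases le_total 0 θ with hθ | hθ
  · exact forall_pos_of_forall_ne_zero (a := 0) (b := θ) γ.continuous_det.continuousOn
      (by rw [h0]; exact one_pos) (fun t _ ↦ γ.det_ne_zero t) θ ⟨hθ, le_rfl⟩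
  · rw [γ.eq_one θ hθ, Matrix.det_one]
    exact one_pos

/-- In particular the end point of a smooth matrix path has positive determinant. [folklore] -/
theorem det_pos_of (γ : SmoothMatrixPath M) : 0 < M.det := by
  simpa [γ.eq_self 1 le_rfl] using γ.det_pos 1

/-- **A smooth matrix path as a path in `GL⁺(n, ℝ)`** from `1` to its end point (restriction to
`[0, 1]`); its class is the straightening it represents. [cite: GompfAGT2010, Def. 4.1] -/
def toPath (γ : SmoothMatrixPath M) : Path (1 : PosDetMatrix m) ⟨M, γ.det_pos_of⟩ where
  toFun t := ⟨γ.toFun t, γ.det_pos t⟩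
  continuous_toFun := (γ.continuous.comp continuous_subtype_val).subtype_mk _
  source' := Subtype.ext (γ.eq_one 0 le_rfl)
  target' := Subtype.ext (γ.eq_self 1 le_rfl)

/-- Values of `toPath`. [folklore] -/
@[simp] theorem coe_toPath_apply (γ : SmoothMatrixPath M) (t : I) :
    ((γ.toPath t : PosDetMatrix m) : Matrix (Fin m) (Fin m) ℝ) = γ.toFun t := rfl

/-- Transported paths have the same values. [folklore] -/
@[simp] theorem cast_toFun (γ : SmoothMatrixPath M) (h : M = N) : (γ.cast h).toFun = γ.toFun :=
  rfl

/-- Transport along `rfl` is the identity. [folklore] -/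
theorem cast_rfl (γ : SmoothMatrixPath M) : γ.cast rfl = γ := rfl

/-- **Concatenation of a path with a left translate of another**: `γ` from `1` to `M` on
`[0, 1/2]`, followed by `θ ↦ δ(2θ - 1) M` from `M` to `P M` on `[1/2, 1]`; smooth because both
paths are constant near their ends. With `δ` a reparametrised linear segment this is Gompf's
`τ·σ` (a straightening followed by a linear path), read from `1`. [cite: GompfAGT2010, §4 ¶2 (τ·σ by path concatenation)] -/
def concat (γ : SmoothMatrixPath M) (δ : SmoothMatrixPath P) : SmoothMatrixPath (P * M) where
  toFun θ := δ.toFun (2 * θ - 1) * γ.toFun (2 * θ)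
  inv θ := γ.inv (2 * θ) * δ.inv (2 * θ - 1)
  contDiff_apply := contDiff_mul_apply
    (fun i j ↦ (δ.contDiff_apply i j).comp ((contDiff_const.mul contDiff_id).sub contDiff_const))
    (fun i j ↦ (γ.contDiff_apply i j).comp (contDiff_const.mul contDiff_id))
  contDiff_inv_apply := contDiff_mul_apply
    (fun i j ↦ (γ.contDiff_inv_apply i j).comp (contDiff_const.mul contDiff_id))
    (fun i j ↦ (δ.contDiff_inv_apply i j).comp ((contDiff_const.mul contDiff_id).sub contDiff_const))
  mul_inv θ := by
    rw [Matrix.mul_assoc, ← Matrix.mul_assoc (γ.toFun _), γ.mul_inv, Matrix.one_mul, δ.mul_inv]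
  inv_mul θ := by
    rw [Matrix.mul_assoc, ← Matrix.mul_assoc (δ.inv _), δ.inv_mul, Matrix.one_mul, γ.inv_mul]
  eq_one θ hθ := by rw [δ.eq_one _ (by linarith), γ.eq_one _ (by linarith), Matrix.one_mul]
  eq_self θ hθ := by rw [δ.eq_self _ (by linarith), γ.eq_self _ (by linarith)]

/-- On `[0, 1/2]` the concatenation runs through `γ` at double speed. [folklore] -/
theorem concat_toFun_of_le_half (γ : SmoothMatrixPath M) (δ : SmoothMatrixPath P) {θ : ℝ}
    (hθ : θ ≤ 1 / 2) : (γ.concat δ).toFun θ = γ.toFun (2 * θ) := by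
  show δ.toFun (2 * θ - 1) * γ.toFun (2 * θ) = _
  rw [δ.eq_one _ (by linarith), Matrix.one_mul]

/-- On `[1/2, 1]` the concatenation runs through `δ · M` at double speed. [folklore] -/
theorem concat_toFun_of_half_le (γ : SmoothMatrixPath M) (δ : SmoothMatrixPath P) {θ : ℝ}
    (hθ : 1 / 2 ≤ θ) : (γ.concat δ).toFun θ = δ.toFun (2 * θ - 1) * M := by
  show δ.toFun (2 * θ - 1) * γ.toFun (2 * θ) = _
  rw [γ.eq_self _ (by linarith)]

end SmoothMatrixPath

/-! ### Linear segments in `GL⁺(n, ℝ)` -/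

section Segments

variable {m : ℕ}

/-- **The straight segment `t ↦ (1 - t) a + t b`** between two matrices of positive determinant,
as a path in `GL⁺(n, ℝ)` when it stays in `GL⁺(n, ℝ)` ("linearly connecting" matrices, Gompf
2010, proof of Thm 4.3). [cite: GompfAGT2010, Thm 4.3 (proof: the 1-cycle τ·ρ)] -/
def segmentPath (a b : PosDetMatrix m) (h : ∀ t ∈ I, 0 < ((1 - t) • a.1 + t • b.1).det) :
    Path a b where
  toFun t := ⟨(1 - (t : ℝ)) • a.1 + (t : ℝ) • b.1, h t t.2⟩
  continuous_toFun := Continuous.subtype_mk (by fun_prop) _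
  source' := by ext : 1; simp
  target' := by ext : 1; simp

/-- Values of `segmentPath`. [folklore] -/
@[simp] theorem coe_segmentPath_apply (a b : PosDetMatrix m)
    (h : ∀ t ∈ I, 0 < ((1 - t) • a.1 + t • b.1).det) (t : I) :
    ((segmentPath a b h t : PosDetMatrix m) : Matrix (Fin m) (Fin m) ℝ) =
      (1 - (t : ℝ)) • a.1 + (t : ℝ) • b.1 := rfl

/-- The reversed segment is the segment between the exchanged end points. [folklore] -/
theorem segmentPath_symm (a b : PosDetMatrix m) (h : ∀ t ∈ I, 0 < ((1 - t) • a.1 + t • b.1).det)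
    (h' : ∀ t ∈ I, 0 < ((1 - t) • b.1 + t • a.1).det) :
    (segmentPath a b h).symm = segmentPath b a h' := by
  refine Path.ext (funext fun t ↦ Subtype.ext ?_)
  simp only [Path.symm_apply, Function.comp_apply, coe_segmentPath_apply, unitInterval.coe_symm_eq]
  rw [sub_sub_cancel, add_comm]

/-- Mathlib's smooth transition function as a self-map of the unit interval. [folklore] -/
def transitionI (t : I) : I :=
  ⟨Real.smoothTransition t, Real.smoothTransition.nonneg _, Real.smoothTransition.le_one _⟩

/-- Values of `transitionI`. [folklore] -/
@[simp] theorem coe_transitionI (t : I) : ((transitionI t : I) : ℝ) = Real.smoothTransition t := rfl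

/-- `transitionI` is continuous. [folklore] -/
theorem continuous_transitionI : Continuous transitionI :=
  (Real.smoothTransition.continuous.comp continuous_subtype_val).subtype_mk _

/-- `transitionI 0 = 0`. [folklore] -/
theorem transitionI_zero : transitionI 0 = 0 := Subtype.ext Real.smoothTransition.zero

/-- `transitionI 1 = 1`. [folklore] -/
theorem transitionI_one : transitionI 1 = 1 := Subtype.ext Real.smoothTransition.one

/-- **A linear straightening, as a path in `GL⁺(3, ℝ)`**: the segment from `1` to `b`
reparametrised by the smooth transition, for `b` linearly straightenable (the path underlying
`linearStraighteningPath`, with end point the point `b` itself). [cite: GompfAGT2010, Def. 4.1 and Prop. 4.2 (linear straightening)] -/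
def linearStraighteningPathAt (b : PosDetMatrix 3) (hb : IsLinearlyStraightenable b.1) :
    Path (1 : PosDetMatrix 3) b where
  toFun θ := ⟨linearPath b.1 (Real.smoothTransition θ),
    hb.det_linearPath_pos _ ⟨Real.smoothTransition.nonneg _, Real.smoothTransition.le_one _⟩⟩
  continuous_toFun := by
    refine Continuous.subtype_mk ?_ _
    unfold linearPath
    fun_prop
  source' := by
    ext : 1
    simp [Real.smoothTransition.zero]
  target' := by
    ext : 1
    simp [Real.smoothTransition.one]

/-- Values of `linearStraighteningPathAt`. [folklore] -/
@[simp] theorem coe_linearStraighteningPathAt_apply (b : PosDetMatrix 3)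
    (hb : IsLinearlyStraightenable b.1) (θ : I) :
    ((linearStraighteningPathAt b hb θ : PosDetMatrix 3) : Matrix (Fin 3) (Fin 3) ℝ) =
      linearPath b.1 (Real.smoothTransition θ) := rfl

/-- `linearStraighteningPath` and `linearStraighteningPathAt` are the same path. [folklore] -/
theorem toPath_linearStraighteningPath {P : Matrix (Fin 3) (Fin 3) ℝ}
    (hP : IsLinearlyStraightenable P) :
    (linearStraighteningPath P hP).toPath =
      linearStraighteningPathAt ⟨P, (linearStraighteningPath P hP).det_pos_of⟩ hP :=
  Path.ext (funext fun _ ↦ rfl)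

/-- A linear straightening is the reparametrised segment from `1`. [cite: GompfAGT2010, Def. 4.1 and Prop. 4.2 (linear straightening)] -/
theorem linearStraighteningPathAt_eq_reparam (b : PosDetMatrix 3)
    (hb : IsLinearlyStraightenable b.1) (h : ∀ t ∈ I, 0 < ((1 - t) • (1 : PosDetMatrix 3).1 + t • b.1).det) :
    linearStraighteningPathAt b hb = (segmentPath 1 b h).reparam
        transitionI continuous_transitionI transitionI_zero transitionI_one := by
  refine Path.ext (funext fun t ↦ Subtype.ext ?_)
  simp only [coe_linearStraighteningPathAt_apply, Path.coe_reparam, Function.comp_apply,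
    coe_segmentPath_apply, coe_transitionI, PosDetMatrix.coe_one]
  simp only [linearPath, add_comm]

/-- The segment from `1` to a linearly straightenable `b` stays in `GL⁺`. [cite: GompfAGT2010, Def. 4.1 and Prop. 4.2 (linear straightening)] -/
theorem det_segment_one_pos (b : PosDetMatrix 3) (hb : IsLinearlyStraightenable b.1) :
    ∀ t ∈ I, 0 < ((1 - t) • (1 : PosDetMatrix 3).1 + t • b.1).det := by
  intro t ht
  have : (1 - t) • (1 : PosDetMatrix 3).1 + t • b.1 = linearPath b.1 t := by
    simp only [linearPath, PosDetMatrix.coe_one, add_comm]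
  rw [this]
  exact hb.det_linearPath_pos t ht

/-- **In the fundamental groupoid a linear straightening is the segment from `1`.** [cite: GompfAGT2010, Def. 4.1 and Prop. 4.2 (linear straightening)] -/
theorem mk_linearStraighteningPathAt (b : PosDetMatrix 3) (hb : IsLinearlyStraightenable b.1) :
    Path.Homotopic.Quotient.mk (linearStraighteningPathAt b hb) =
      Path.Homotopic.Quotient.mk (segmentPath 1 b (det_segment_one_pos b hb)) := by
  rw [linearStraighteningPathAt_eq_reparam b hb (det_segment_one_pos b hb)]
  exact Path.Homotopic.Quotient.eq.2 ⟨(Path.Homotopy.reparam _ _ continuous_transitionI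
    transitionI_zero transitionI_one).symm⟩

end Segments

/-! ### Sliding the end point: a homotopy lemma -/

section Slide

variable {X : Type*} [TopologicalSpace X] {x y z : X}

/-- The affine reparametrisation `u ↦ s + (1 - s) u` of the unit interval onto `[s, 1]`. [folklore] -/
def tailParam (p : I × I) : I :=
  ⟨(p.1 : ℝ) + (1 - p.1) * p.2, by
    constructor
    · nlinarith [p.1.2.1, p.1.2.2, p.2.2.1, p.2.2.2]
    · nlinarith [p.1.2.1, p.1.2.2, p.2.2.1, p.2.2.2]⟩

/-- `tailParam` is continuous. [folklore] -/
theorem continuous_tailParam : Continuous (tailParam) :=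
  Continuous.subtype_mk (by fun_prop) _

/-- The tail `u ↦ c (s + (1 - s) u)` of a path `c` from the parameter `s` on, as a path from `c s`
to the end point. [folklore] -/
def pathTail (c : Path y z) (s : I) : Path (c s) z where
  toFun u := c (tailParam (s, u))
  continuous_toFun := c.continuous.comp (continuous_tailParam.comp (by fun_prop))
  source' := by
    show c _ = c s
    congr 1
    ext
    simp [tailParam]
  target' := by
    show c _ = z
    conv_rhs => rw [← c.target]
    congr 1
    ext
    simp [tailParam]

/-- The tails of a path form a continuous family. [folklore] -/
theorem continuous_pathTail (c : Path y z) : Continuous ↿(pathTail c) :=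
  c.continuous.comp continuous_tailParam

/-- **Sliding the end point along a path.** If `F s` is a continuous family of paths from `x` to
`c s`, where `c` is a path from `y` to `z`, then `F 0` followed by `c` is homotopic to `F 1`
(rel end points): at time `s` use `F s` followed by the tail of `c` from `s` on. [folklore] -/
theorem homotopic_slide (c : Path y z) (F : ∀ s : I, Path x (c s)) (hF : Continuous ↿F) :
    (((F 0).cast rfl c.source.symm).trans c).Homotopic ((F 1).cast rfl c.target.symm) := by
  have key : ((F 0).trans (pathTail c 0)).Homotopic ((F 1).trans (pathTail c 1)) :=
    ⟨{ toFun := fun p ↦ ((F p.1).trans (pathTail c p.1)) p.2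
       continuous_toFun := Path.trans_continuous_family F hF (pathTail c) (continuous_pathTail c)
       map_zero_left := fun _ ↦ rfl
       map_one_left := fun _ ↦ rfl
       prop' := fun s θ hθ ↦ by
         simp only [Set.mem_insert_iff, Set.mem_singleton_iff] at hθ
         rcases hθ with rfl | rfl
         · simp
         · simp }⟩
  have h0 : (F 0).trans (pathTail c 0) = ((F 0).cast rfl c.source.symm).trans c := by
    refine Path.ext (funext fun t ↦ ?_)
    rw [Path.trans_apply, Path.trans_apply]
    split_ifs with h
    · rfl
    · show c _ = c _
      congr 1
      ext
      simp [tailParam]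
  have h1 : (F 1).trans (pathTail c 1) = ((F 1).cast rfl c.target.symm).trans (Path.refl z) := by
    refine Path.ext (funext fun t ↦ ?_)
    rw [Path.trans_apply, Path.trans_apply]
    split_ifs with h
    · rfl
    · show c _ = z
      conv_rhs => rw [← c.target]
      congr 1
      ext
      simp [tailParam]
  rw [h0, h1] at key
  exact key.trans (Path.Homotopic.trans_refl _)

end Slide

/-! ### The matrices of the chain as points of `GL⁺(3, ℝ)`; Δ-segments -/

section Points

/-- The point `A ∈ SL(3, ℤ) ⊂ GL⁺(3, ℝ)`. [folklore] -/
abbrev slPoint (A : Matrix.SpecialLinearGroup (Fin 3) ℤ) : PosDetMatrix 3 :=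
  ⟨slRealMatrix A, by rw [det_slRealMatrix]; exact one_pos⟩

/-- The matrix of `slPoint A`. [folklore] -/
theorem coe_slPoint (A : Matrix.SpecialLinearGroup (Fin 3) ℤ) :
    (slPoint A : Matrix (Fin 3) (Fin 3) ℝ) = slRealMatrix A := rfl

/-- **Powers of `Δ₀`**: `Δ₀ ^ k = !![1, 0, k; 0, 1, -2k; 0, 0, 1]`. [cite: GompfAGT2010, §4 (the matrix Δ₀)] -/
theorem coe_gompfDeltaZero_zpow (k : ℤ) :
    ((gompfDeltaZero ^ k : Matrix.SpecialLinearGroup (Fin 3) ℤ) : Matrix (Fin 3) (Fin 3) ℤ) =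
      !![1, 0, k; 0, 1, -(2 * k); 0, 0, 1] := by
  induction k using Int.induction_on with
  | zero => simp [Matrix.one_fin_three]
  | succ n ih =>
    rw [_root_.zpow_add_one, Matrix.SpecialLinearGroup.coe_mul, ih, coe_gompfDeltaZero]
    ext i j
    fin_cases i <;> fin_cases j <;> simp [Matrix.mul_apply, Fin.sum_univ_three] <;> ring
  | pred n ih =>
    have hinv : ((gompfDeltaZero⁻¹ : Matrix.SpecialLinearGroup (Fin 3) ℤ) :
        Matrix (Fin 3) (Fin 3) ℤ) = !![1, 0, -1; 0, 1, 2; 0, 0, 1] := by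
      rw [Matrix.SpecialLinearGroup.coe_inv, coe_gompfDeltaZero]
      decide
    rw [_root_.zpow_sub_one, Matrix.SpecialLinearGroup.coe_mul, ih, hinv]
    ext i j
    fin_cases i <;> fin_cases j <;> simp [Matrix.mul_apply, Fin.sum_univ_three] <;> ring

/-- The real segment matrix `t Δᵏ + (1 - t) I = !![1, -tk, 0; 0, 1, 0; 0, tk, 1]`. [cite: GompfAGT2010, §4 ¶3 (the linear path from Δᵏ to I lies in SL(3, ℝ))] -/
theorem linearPath_slRealMatrix_gompfDelta_zpow (k : ℤ) (t : ℝ) :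
    linearPath (slRealMatrix (gompfDelta ^ k)) t = !![1, -(t * k), 0; 0, 1, 0; 0, t * k, 1] := by
  ext i j
  simp only [linearPath_apply, slRealMatrix_apply, coe_gompfDelta_zpow]
  fin_cases i <;> fin_cases j <;> simp

/-- The real segment matrix `t Δ₀ᵏ + (1 - t) I = !![1, 0, tk; 0, 1, -2tk; 0, 0, 1]`. [cite: GompfAGT2010, §4 ¶5 (the matrix Δ₀)] -/
theorem linearPath_slRealMatrix_gompfDeltaZero_zpow (k : ℤ) (t : ℝ) :
    linearPath (slRealMatrix (gompfDeltaZero ^ k)) t =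
      !![1, 0, t * k; 0, 1, -(2 * (t * k)); 0, 0, 1] := by
  ext i j
  simp only [linearPath_apply, slRealMatrix_apply, coe_gompfDeltaZero_zpow]
  fin_cases i <;> fin_cases j <;> simp
  ring

/-- **"The linear path from `Δᵏ` to `I` clearly lies in `SL(3, ℝ)`"**: its determinant is
identically `1`. [cite: GompfAGT2010, §4 ¶3 (the linear path from Δᵏ to I lies in SL(3, ℝ))] -/
theorem det_linearPath_slRealMatrix_gompfDelta_zpow (k : ℤ) (t : ℝ) :
    (linearPath (slRealMatrix (gompfDelta ^ k)) t).det = 1 := by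
  rw [linearPath_slRealMatrix_gompfDelta_zpow]
  simp [Matrix.det_fin_three]

/-- The linear path from `Δ₀ᵏ` to `I` lies in `SL(3, ℝ)` as well. [cite: GompfAGT2010, §4 ¶5 (the matrix Δ₀)] -/
theorem det_linearPath_slRealMatrix_gompfDeltaZero_zpow (k : ℤ) (t : ℝ) :
    (linearPath (slRealMatrix (gompfDeltaZero ^ k)) t).det = 1 := by
  rw [linearPath_slRealMatrix_gompfDeltaZero_zpow]
  simp [Matrix.det_fin_three]

/-- `Δᵏ` is linearly straightenable. [cite: GompfAGT2010, §4 ¶3 (the linear path from Δᵏ to I lies in SL(3, ℝ))] -/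
theorem isLinearlyStraightenable_gompfDelta_zpow (k : ℤ) :
    IsLinearlyStraightenable (slRealMatrix (gompfDelta ^ k)) := fun t _ ↦ by
  rw [det_linearPath_slRealMatrix_gompfDelta_zpow]
  exact isUnit_one

/-- `Δ₀ᵏ` is linearly straightenable. [cite: GompfAGT2010, §4 ¶5 (the matrix Δ₀)] -/
theorem isLinearlyStraightenable_gompfDeltaZero_zpow (k : ℤ) :
    IsLinearlyStraightenable (slRealMatrix (gompfDeltaZero ^ k)) := fun t _ ↦ by
  rw [det_linearPath_slRealMatrix_gompfDeltaZero_zpow]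
  exact isUnit_one

/-- `A P A⁻¹` is linearly straightenable when `P` is ("linearity is preserved when we undo the
change of basis"). [cite: GompfAGT2010, §4 ¶3 (linearity is preserved under change of basis)] -/
theorem isLinearlyStraightenable_slRealMatrix_conj (A P : Matrix.SpecialLinearGroup (Fin 3) ℤ)
    (hP : IsLinearlyStraightenable (slRealMatrix P)) :
    IsLinearlyStraightenable (slRealMatrix (A * P * A⁻¹)) := by
  rw [slRealMatrix_mul, slRealMatrix_mul]
  exact hP.conj _ _ (slRealMatrix_mul_inv A)

/-- **The segment of the row move stays in `SL(3, ℝ)`**: `(1 - t) A + t P A = (t P + (1 - t) I) A`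
has determinant `1` for `P = Δᵏ`. [cite: GompfAGT2010, §4 ¶3 (the linear path τ from B to A lies in SL(3, ℝ))] -/
theorem det_segment_gompfDelta_zpow_mul (A : Matrix.SpecialLinearGroup (Fin 3) ℤ) (k : ℤ) :
    ∀ t ∈ I, 0 < ((1 - t) • (slPoint A).1 + t • (slPoint (gompfDelta ^ k * A)).1).det := by
  intro t _
  have : (1 - t) • (slPoint A).1 + t • (slPoint (gompfDelta ^ k * A)).1 =
      linearPath (slRealMatrix (gompfDelta ^ k)) t * slRealMatrix A := by
    rw [coe_slPoint, coe_slPoint, slRealMatrix_mul, linearPath, Matrix.add_mul, Matrix.smul_mul,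
      Matrix.smul_mul, Matrix.one_mul, add_comm]
  rw [this, Matrix.det_mul, det_linearPath_slRealMatrix_gompfDelta_zpow, det_slRealMatrix]
  norm_num

/-- The segment of the column move `A ↦ A Δᵏ` stays in `SL(3, ℝ)`:
`(1 - t) A + t A P = A (t P + (1 - t) I)`. [cite: GompfAGT2010, §4 ¶3 (the linear path τ from B to A lies in SL(3, ℝ))] -/
theorem det_segment_mul_gompfDelta_zpow (A : Matrix.SpecialLinearGroup (Fin 3) ℤ) (k : ℤ) :
    ∀ t ∈ I, 0 < ((1 - t) • (slPoint A).1 + t • (slPoint (A * gompfDelta ^ k)).1).det := by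
  intro t _
  have : (1 - t) • (slPoint A).1 + t • (slPoint (A * gompfDelta ^ k)).1 =
      slRealMatrix A * linearPath (slRealMatrix (gompfDelta ^ k)) t := by
    rw [coe_slPoint, coe_slPoint, slRealMatrix_mul, linearPath, Matrix.mul_add, Matrix.mul_smul,
      Matrix.mul_smul, Matrix.mul_one, add_comm]
  rw [this, Matrix.det_mul, det_linearPath_slRealMatrix_gompfDelta_zpow, det_slRealMatrix]
  norm_num

/-- The segment of the row move `A ↦ Δ₀ᵏ A` stays in `SL(3, ℝ)`. [cite: GompfAGT2010, §4 ¶5 (the matrix Δ₀)] -/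
theorem det_segment_gompfDeltaZero_zpow_mul (A : Matrix.SpecialLinearGroup (Fin 3) ℤ) (k : ℤ) :
    ∀ t ∈ I, 0 < ((1 - t) • (slPoint A).1 + t • (slPoint (gompfDeltaZero ^ k * A)).1).det := by
  intro t _
  have : (1 - t) • (slPoint A).1 + t • (slPoint (gompfDeltaZero ^ k * A)).1 =
      linearPath (slRealMatrix (gompfDeltaZero ^ k)) t * slRealMatrix A := by
    rw [coe_slPoint, coe_slPoint, slRealMatrix_mul, linearPath, Matrix.add_mul, Matrix.smul_mul,
      Matrix.smul_mul, Matrix.one_mul, add_comm]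
  rw [this, Matrix.det_mul, det_linearPath_slRealMatrix_gompfDeltaZero_zpow, det_slRealMatrix]
  norm_num

/-- The segment of the column move `A ↦ A Δ₀ᵏ` stays in `SL(3, ℝ)`. [cite: GompfAGT2010, §4 ¶5 (the matrix Δ₀)] -/
theorem det_segment_mul_gompfDeltaZero_zpow (A : Matrix.SpecialLinearGroup (Fin 3) ℤ) (k : ℤ) :
    ∀ t ∈ I, 0 < ((1 - t) • (slPoint A).1 + t • (slPoint (A * gompfDeltaZero ^ k)).1).det := by
  intro t _
  have : (1 - t) • (slPoint A).1 + t • (slPoint (A * gompfDeltaZero ^ k)).1 =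
      slRealMatrix A * linearPath (slRealMatrix (gompfDeltaZero ^ k)) t := by
    rw [coe_slPoint, coe_slPoint, slRealMatrix_mul, linearPath, Matrix.mul_add, Matrix.mul_smul,
      Matrix.mul_smul, Matrix.mul_one, add_comm]
  rw [this, Matrix.det_mul, det_linearPath_slRealMatrix_gompfDeltaZero_zpow, det_slRealMatrix]
  norm_num

end Points

/-! ### Gompf's `τ·σ`: a straightening followed by the segment of a Δ-move; conjugate straightenings -/

namespace SmoothMatrixPath

variable {A : Matrix.SpecialLinearGroup (Fin 3) ℤ}

/-- Transport of a framing path along an equality of matrices in `SL(3, ℤ)`. [folklore] -/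
def along (γ : SmoothMatrixPath (slRealMatrix A)) {B : Matrix.SpecialLinearGroup (Fin 3) ℤ}
    (h : A = B) : SmoothMatrixPath (slRealMatrix B) :=
  γ.cast (congrArg slRealMatrix h)

/-- Transported paths have the same values. [folklore] -/
@[simp] theorem along_toFun (γ : SmoothMatrixPath (slRealMatrix A))
    {B : Matrix.SpecialLinearGroup (Fin 3) ℤ} (h : A = B) : (γ.along h).toFun = γ.toFun := rfl

/-- Transport along `rfl` is the identity. [folklore] -/
theorem along_rfl (γ : SmoothMatrixPath (slRealMatrix A)) : γ.along rfl = γ := rfl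

/-- **`τ·σ` for the row move `A ↦ Δᵏ A`**: the path `γ` from `1` to `A` followed by the straight
segment from `A` to `Δᵏ A` (reparametrised by the smooth transition so that the concatenation is
smooth and constant near its ends) — Gompf's "`τ·σ`, `τ` the linear path from `B = Δᵏ A` to `A`",
read from `1` (Gompf 2010, §4 ¶3). [cite: GompfAGT2010, §4 ¶3 (X^{τ·σ}_B = X^σ_A for B = Δᵏ A)] -/
def deltaLeft (γ : SmoothMatrixPath (slRealMatrix A)) (k : ℤ) :
    SmoothMatrixPath (slRealMatrix (gompfDelta ^ k * A)) :=
  (γ.concat (linearStraighteningPath _ (isLinearlyStraightenable_gompfDelta_zpow k))).cast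
    (slRealMatrix_mul _ _).symm

/-- **`τ·σ` for the column move `A ↦ A Δᵏ`**: `γ` followed by the straight segment from `A` to
`A Δᵏ = (A Δᵏ A⁻¹) A` (Gompf 2010, §4 ¶3). [cite: GompfAGT2010, §4 ¶3 (X^{τ·σ}_B = X^σ_A for B = A Δᵏ)] -/
def deltaRight (γ : SmoothMatrixPath (slRealMatrix A)) (k : ℤ) :
    SmoothMatrixPath (slRealMatrix (A * gompfDelta ^ k)) :=
  (γ.concat (linearStraighteningPath _ (isLinearlyStraightenable_slRealMatrix_conj A _
    (isLinearlyStraightenable_gompfDelta_zpow k)))).cast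
    (by rw [← slRealMatrix_mul, inv_mul_cancel_right])

/-- **`τ·σ` for the row move `A ↦ Δ₀ᵏ A`** (Gompf 2010, §4 ¶5). [cite: GompfAGT2010, §4 ¶5 (X^{τ·σ}_B = X^σ_A for B = Δ₀ᵏ A or A Δ₀ᵏ)] -/
def deltaZeroLeft (γ : SmoothMatrixPath (slRealMatrix A)) (k : ℤ) :
    SmoothMatrixPath (slRealMatrix (gompfDeltaZero ^ k * A)) :=
  (γ.concat (linearStraighteningPath _ (isLinearlyStraightenable_gompfDeltaZero_zpow k))).cast
    (slRealMatrix_mul _ _).symm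

/-- **`τ·σ` for the column move `A ↦ A Δ₀ᵏ`** (Gompf 2010, §4 ¶5). [cite: GompfAGT2010, §4 ¶5 (X^{τ·σ}_B = X^σ_A for B = Δ₀ᵏ A or A Δ₀ᵏ)] -/
def deltaZeroRight (γ : SmoothMatrixPath (slRealMatrix A)) (k : ℤ) :
    SmoothMatrixPath (slRealMatrix (A * gompfDeltaZero ^ k)) :=
  (γ.concat (linearStraighteningPath _ (isLinearlyStraightenable_slRealMatrix_conj A _
    (isLinearlyStraightenable_gompfDeltaZero_zpow k)))).cast
    (by rw [← slRealMatrix_mul, inv_mul_cancel_right])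

/-- **The conjugate straightening `C γ C⁻¹`** of `C A C⁻¹` ("conjugation preserves linear
straightenings", Gompf 2010, proof of Thm 4.3). [cite: GompfAGT2010, Thm 4.3 (proof: conjugation preserves linear straightenings)] -/
def conj (γ : SmoothMatrixPath (slRealMatrix A)) (C : Matrix.SpecialLinearGroup (Fin 3) ℤ) :
    SmoothMatrixPath (slRealMatrix (C * A * C⁻¹)) where
  toFun θ := slRealMatrix C * γ.toFun θ * slRealMatrix C⁻¹
  inv θ := slRealMatrix C * γ.inv θ * slRealMatrix C⁻¹
  contDiff_apply := contDiff_mul_apply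
    (contDiff_mul_apply (fun _ _ ↦ contDiff_const) γ.contDiff_apply) fun _ _ ↦ contDiff_const
  contDiff_inv_apply := contDiff_mul_apply
    (contDiff_mul_apply (fun _ _ ↦ contDiff_const) γ.contDiff_inv_apply) fun _ _ ↦ contDiff_const
  mul_inv θ := by
    simp only [Matrix.mul_assoc]
    rw [← Matrix.mul_assoc (slRealMatrix C⁻¹) (slRealMatrix C), slRealMatrix_inv_mul,
      Matrix.one_mul, ← Matrix.mul_assoc (γ.toFun θ), γ.mul_inv, Matrix.one_mul,
      slRealMatrix_mul_inv]
  inv_mul θ := by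
    simp only [Matrix.mul_assoc]
    rw [← Matrix.mul_assoc (slRealMatrix C⁻¹) (slRealMatrix C), slRealMatrix_inv_mul,
      Matrix.one_mul, ← Matrix.mul_assoc (γ.inv θ), γ.inv_mul, Matrix.one_mul,
      slRealMatrix_mul_inv]
  eq_one θ hθ := by rw [γ.eq_one θ hθ, Matrix.mul_one, slRealMatrix_mul_inv]
  eq_self θ hθ := by rw [γ.eq_self θ hθ, slRealMatrix_mul, slRealMatrix_mul]

/-- Values of the conjugate path. [folklore] -/
@[simp] theorem conj_toFun (γ : SmoothMatrixPath (slRealMatrix A))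
    (C : Matrix.SpecialLinearGroup (Fin 3) ℤ) (θ : ℝ) :
    (γ.conj C).toFun θ = slRealMatrix C * γ.toFun θ * slRealMatrix C⁻¹ := rfl

/-- **`deltaLeft` in the fundamental groupoid**: `[γ.deltaLeft k] = [γ] · [segment A → Δᵏ A]`
(after transport along any `Δᵏ A = B`). [cite: GompfAGT2010, §4 ¶2 (τ·σ by path concatenation)] -/
theorem mk_toPath_deltaLeft (γ : SmoothMatrixPath (slRealMatrix A)) (k : ℤ)
    {B : Matrix.SpecialLinearGroup (Fin 3) ℤ} (e : gompfDelta ^ k * A = B)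
    (h : ∀ t ∈ I, 0 < ((1 - t) • (slPoint A).1 + t • (slPoint B).1).det) :
    Path.Homotopic.Quotient.mk ((γ.deltaLeft k).along e).toPath =
      (Path.Homotopic.Quotient.mk γ.toPath).trans
        (Path.Homotopic.Quotient.mk (segmentPath (slPoint A) (slPoint B) h)) := by
  subst e
  have heq : ((γ.deltaLeft k).along rfl).toPath = γ.toPath.trans
      ((segmentPath (slPoint A) (slPoint (gompfDelta ^ k * A)) h).reparam
        transitionI continuous_transitionI transitionI_zero transitionI_one) := by
    refine Path.ext (funext fun t ↦ ?_)
    rw [Path.trans_apply]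
    apply Subtype.ext
    split_ifs with ht
    · exact γ.concat_toFun_of_le_half _ ht
    · show (γ.concat _).toFun t = _
      rw [γ.concat_toFun_of_half_le _ (not_le.1 ht).le, linearStraighteningPath_toFun]
      simp only [Path.coe_reparam, Function.comp_apply, coe_segmentPath_apply, coe_transitionI]
      rw [linearPath, Matrix.add_mul, Matrix.smul_mul, Matrix.smul_mul, Matrix.one_mul,
        ← slRealMatrix_mul, add_comm]
  rw [heq, Path.Homotopic.Quotient.mk_trans]
  exact congrArg _ (Path.Homotopic.Quotient.eq.2 ⟨(Path.Homotopy.reparam _ _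
    continuous_transitionI transitionI_zero transitionI_one).symm⟩)

/-- **`deltaRight` in the fundamental groupoid**: `[γ.deltaRight k] = [γ] · [segment A → A Δᵏ]`. [cite: GompfAGT2010, §4 ¶2 (τ·σ by path concatenation)] -/
theorem mk_toPath_deltaRight (γ : SmoothMatrixPath (slRealMatrix A)) (k : ℤ)
    {B : Matrix.SpecialLinearGroup (Fin 3) ℤ} (e : A * gompfDelta ^ k = B)
    (h : ∀ t ∈ I, 0 < ((1 - t) • (slPoint A).1 + t • (slPoint B).1).det) :
    Path.Homotopic.Quotient.mk ((γ.deltaRight k).along e).toPath =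
      (Path.Homotopic.Quotient.mk γ.toPath).trans
        (Path.Homotopic.Quotient.mk (segmentPath (slPoint A) (slPoint B) h)) := by
  subst e
  have heq : ((γ.deltaRight k).along rfl).toPath = γ.toPath.trans
      ((segmentPath (slPoint A) (slPoint (A * gompfDelta ^ k)) h).reparam
        transitionI continuous_transitionI transitionI_zero transitionI_one) := by
    refine Path.ext (funext fun t ↦ ?_)
    rw [Path.trans_apply]
    apply Subtype.ext
    split_ifs with ht
    · exact γ.concat_toFun_of_le_half _ ht
    · show (γ.concat _).toFun t = _
      rw [γ.concat_toFun_of_half_le _ (not_le.1 ht).le, linearStraighteningPath_toFun]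
      simp only [Path.coe_reparam, Function.comp_apply, coe_segmentPath_apply, coe_transitionI]
      rw [slRealMatrix_mul, slRealMatrix_mul, linearPath_conj _ _ _ (slRealMatrix_mul_inv A),
        Matrix.mul_assoc, slRealMatrix_inv_mul, Matrix.mul_one, linearPath, Matrix.mul_add,
        Matrix.mul_smul, Matrix.mul_smul, Matrix.mul_one, ← slRealMatrix_mul, add_comm]
  rw [heq, Path.Homotopic.Quotient.mk_trans]
  exact congrArg _ (Path.Homotopic.Quotient.eq.2 ⟨(Path.Homotopy.reparam _ _
    continuous_transitionI transitionI_zero transitionI_one).symm⟩)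

/-- **`deltaZeroLeft` in the fundamental groupoid**: `[γ.deltaZeroLeft k] = [γ] · [segment A → Δ₀ᵏ A]`. [cite: GompfAGT2010, §4 ¶2 (τ·σ by path concatenation)] -/
theorem mk_toPath_deltaZeroLeft (γ : SmoothMatrixPath (slRealMatrix A)) (k : ℤ)
    {B : Matrix.SpecialLinearGroup (Fin 3) ℤ} (e : gompfDeltaZero ^ k * A = B)
    (h : ∀ t ∈ I, 0 < ((1 - t) • (slPoint A).1 + t • (slPoint B).1).det) :
    Path.Homotopic.Quotient.mk ((γ.deltaZeroLeft k).along e).toPath =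
      (Path.Homotopic.Quotient.mk γ.toPath).trans
        (Path.Homotopic.Quotient.mk (segmentPath (slPoint A) (slPoint B) h)) := by
  subst e
  have heq : ((γ.deltaZeroLeft k).along rfl).toPath = γ.toPath.trans
      ((segmentPath (slPoint A) (slPoint (gompfDeltaZero ^ k * A)) h).reparam
        transitionI continuous_transitionI transitionI_zero transitionI_one) := by
    refine Path.ext (funext fun t ↦ ?_)
    rw [Path.trans_apply]
    apply Subtype.ext
    split_ifs with ht
    · exact γ.concat_toFun_of_le_half _ ht
    · show (γ.concat _).toFun t = _
      rw [γ.concat_toFun_of_half_le _ (not_le.1 ht).le, linearStraighteningPath_toFun]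
      simp only [Path.coe_reparam, Function.comp_apply, coe_segmentPath_apply, coe_transitionI]
      rw [linearPath, Matrix.add_mul, Matrix.smul_mul, Matrix.smul_mul, Matrix.one_mul,
        ← slRealMatrix_mul, add_comm]
  rw [heq, Path.Homotopic.Quotient.mk_trans]
  exact congrArg _ (Path.Homotopic.Quotient.eq.2 ⟨(Path.Homotopy.reparam _ _
    continuous_transitionI transitionI_zero transitionI_one).symm⟩)

/-- **`deltaZeroRight` in the fundamental groupoid**: `[γ.deltaZeroRight k] = [γ] · [segment A → A Δ₀ᵏ]`. [cite: GompfAGT2010, §4 ¶2 (τ·σ by path concatenation)] -/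
theorem mk_toPath_deltaZeroRight (γ : SmoothMatrixPath (slRealMatrix A)) (k : ℤ)
    {B : Matrix.SpecialLinearGroup (Fin 3) ℤ} (e : A * gompfDeltaZero ^ k = B)
    (h : ∀ t ∈ I, 0 < ((1 - t) • (slPoint A).1 + t • (slPoint B).1).det) :
    Path.Homotopic.Quotient.mk ((γ.deltaZeroRight k).along e).toPath =
      (Path.Homotopic.Quotient.mk γ.toPath).trans
        (Path.Homotopic.Quotient.mk (segmentPath (slPoint A) (slPoint B) h)) := by
  subst e
  have heq : ((γ.deltaZeroRight k).along rfl).toPath = γ.toPath.trans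
      ((segmentPath (slPoint A) (slPoint (A * gompfDeltaZero ^ k)) h).reparam
        transitionI continuous_transitionI transitionI_zero transitionI_one) := by
    refine Path.ext (funext fun t ↦ ?_)
    rw [Path.trans_apply]
    apply Subtype.ext
    split_ifs with ht
    · exact γ.concat_toFun_of_le_half _ ht
    · show (γ.concat _).toFun t = _
      rw [γ.concat_toFun_of_half_le _ (not_le.1 ht).le, linearStraighteningPath_toFun]
      simp only [Path.coe_reparam, Function.comp_apply, coe_segmentPath_apply, coe_transitionI]
      rw [slRealMatrix_mul, slRealMatrix_mul, linearPath_conj _ _ _ (slRealMatrix_mul_inv A),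
        Matrix.mul_assoc, slRealMatrix_inv_mul, Matrix.mul_one, linearPath, Matrix.mul_add,
        Matrix.mul_smul, Matrix.mul_smul, Matrix.mul_one, ← slRealMatrix_mul, add_comm]
  rw [heq, Path.Homotopic.Quotient.mk_trans]
  exact congrArg _ (Path.Homotopic.Quotient.eq.2 ⟨(Path.Homotopy.reparam _ _
    continuous_transitionI transitionI_zero transitionI_one).symm⟩)

end SmoothMatrixPath

/-- **Transport of `X^σ_A` along an equality `A = B` in `SL(3, ℤ)`** is a diffeomorphism (indeed
the identity). [folklore] -/
theorem nonempty_diffeomorph_gompfSphere_along {A B : Matrix.SpecialLinearGroup (Fin 3) ℤ}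
    (γ : SmoothMatrixPath (slRealMatrix A)) (h : A = B) :
    Nonempty (gompfSphere A γ ≃ₘ⟮𝓡 4, 𝓡 4⟯ gompfSphere B (γ.along h)) := by
  subst h
  exact ⟨Diffeomorph.refl _ _ _⟩

/-! ### The 2-simplex of linear straightenings `σ_A, σ_B, ρ` -/

section Simplex

/-- **`σ_A`, the linear straightening of `A = gompfFramingA`** (it exists by Prop. 4.2,
`tr A = 4`). [cite: GompfAGT2010, Thm 4.3 (proof: σ_A, the linear straightening of A)] -/
def gompfSigmaA : SmoothMatrixPath (slRealMatrix gompfFramingA) :=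
  linearStraighteningPath _ isLinearlyStraightenable_gompfFramingA

/-- **`σ_B`, the linear straightening of `B = gompfFramingB`** (`tr B = 4`). [cite: GompfAGT2010, Thm 4.3 (proof: σ_B, the linear straightening of B)] -/
def gompfSigmaB : SmoothMatrixPath (slRealMatrix gompfFramingB) :=
  linearStraighteningPath _ isLinearlyStraightenable_gompfFramingB

/-- The segment `ρ` from `A` to `B` lies in `GL⁺(3, ℝ)` (Gompf: "These matrices all lie in
`GL⁺(3, ℝ)`"; `det B_t = 1`, `GompfStraightening.lean`). [cite: GompfAGT2010, Thm 4.3 (proof: the matrices B_t lie in GL⁺(3, ℝ))] -/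
theorem det_segment_gompfFraming_pos :
    ∀ t ∈ I, 0 < ((1 - t) • (slPoint gompfFramingA).1 + t • (slPoint gompfFramingB).1).det := by
  intro t ht
  have : (1 - t) • (slPoint gompfFramingA).1 + t • (slPoint gompfFramingB).1 =
      gompfFramingSegment t := by
    rw [gompfFramingSegment, coe_slPoint, coe_slPoint, add_comm]
  rw [this]
  exact det_gompfFramingSegment_pos ht.1 ht.2

/-- The reversed segment from `B` to `A` lies in `GL⁺(3, ℝ)` as well. [cite: GompfAGT2010, Thm 4.3 (proof: the matrices B_t lie in GL⁺(3, ℝ))] -/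
theorem det_segment_gompfFraming_pos' :
    ∀ t ∈ I, 0 < ((1 - t) • (slPoint gompfFramingB).1 + t • (slPoint gompfFramingA).1).det := by
  intro t ht
  have := det_segment_gompfFraming_pos (1 - t) ⟨by linarith [ht.2], by linarith [ht.1]⟩
  rwa [sub_sub_cancel, add_comm] at this

/-- **Gompf's segment `ρ`** from `A` to `B`, `B_t = t B + (1 - t) A`, as a path in `GL⁺(3, ℝ)`. [cite: GompfAGT2010, Thm 4.3 (proof: the linear path ρ between A and B)] -/
def gompfRho : Path (slPoint gompfFramingA) (slPoint gompfFramingB) :=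
  segmentPath _ _ det_segment_gompfFraming_pos

/-- The matrix of `ρ(s)` is Gompf's `B_s`. [cite: GompfAGT2010, Thm 4.3 (proof: the linear path ρ between A and B)] -/
theorem coe_gompfRho_apply (s : I) :
    ((gompfRho s : PosDetMatrix 3) : Matrix (Fin 3) (Fin 3) ℝ) = gompfFramingSegment s := by
  rw [gompfRho, coe_segmentPath_apply, gompfFramingSegment, coe_slPoint, coe_slPoint, add_comm]

/-- Every `B_s` can be linearly straightened (Gompf: "These matrices … can be linearly
straightened", by `det (B_t + sI) = s³ + 4s² + [4t(1-t)+3]s + 1 > 0`). [cite: GompfAGT2010, Thm 4.3 (proof: the matrices B_t can be linearly straightened)] -/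
theorem isLinearlyStraightenable_gompfRho (s : I) :
    IsLinearlyStraightenable (gompfRho s : PosDetMatrix 3).1 := by
  rw [show (gompfRho s : PosDetMatrix 3).1 = gompfFramingSegment s from coe_gompfRho_apply s]
  exact isLinearlyStraightenable_gompfFramingSegment s.2.1 s.2.2

/-- **"The linear straightenings comprise a 2-simplex in `GL⁺(3, ℝ)` with edges `σ_A`, `σ_B` and
`ρ`"**: the family `s ↦ σ_{B_s}` of linear straightenings of the matrices of `ρ` is continuous. [cite: GompfAGT2010, Thm 4.3 (proof: the 2-simplex of linear straightenings)] -/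
theorem continuous_linearStraighteningPathAt_gompfRho :
    Continuous ↿fun s : I ↦ linearStraighteningPathAt (gompfRho s) (isLinearlyStraightenable_gompfRho s) := by
  have : Continuous fun p : I × I ↦ (⟨linearPath (gompfRho p.1 : PosDetMatrix 3).1
      (Real.smoothTransition p.2), (isLinearlyStraightenable_gompfRho p.1).det_linearPath_pos _
        ⟨Real.smoothTransition.nonneg _, Real.smoothTransition.le_one _⟩⟩ : PosDetMatrix 3) := by
    refine Continuous.subtype_mk ?_ _
    unfold linearPath
    fun_prop
  exact this

/-- **The 2-simplex: `[σ_B] = [σ_A] · [ρ]`** in the fundamental groupoid of `GL⁺(3, ℝ)` (slide the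
end point of `σ_{B_s}` along `ρ`). [cite: GompfAGT2010, Thm 4.3 (proof: the 2-simplex of linear straightenings)] -/
theorem mk_toPath_gompfSigmaB :
    Path.Homotopic.Quotient.mk gompfSigmaB.toPath =
      (Path.Homotopic.Quotient.mk gompfSigmaA.toPath).trans (Path.Homotopic.Quotient.mk gompfRho) := by
  have hs := homotopic_slide gompfRho
    (fun s ↦ linearStraighteningPathAt (gompfRho s) (isLinearlyStraightenable_gompfRho s))
    continuous_linearStraighteningPathAt_gompfRho
  have h0 : (linearStraighteningPathAt (gompfRho 0) (isLinearlyStraightenable_gompfRho 0)).cast rfl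
      gompfRho.source.symm = gompfSigmaA.toPath := by
    refine Path.ext (funext fun t ↦ Subtype.ext ?_)
    show linearPath (gompfRho 0 : PosDetMatrix 3).1 (Real.smoothTransition t) =
      linearPath (slRealMatrix gompfFramingA) (Real.smoothTransition t)
    rw [gompfRho.source]
  have h1 : (linearStraighteningPathAt (gompfRho 1) (isLinearlyStraightenable_gompfRho 1)).cast rfl
      gompfRho.target.symm = gompfSigmaB.toPath := by
    refine Path.ext (funext fun t ↦ Subtype.ext ?_)
    show linearPath (gompfRho 1 : PosDetMatrix 3).1 (Real.smoothTransition t) =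
      linearPath (slRealMatrix gompfFramingB) (Real.smoothTransition t)
    rw [gompfRho.target]
  rw [h0, h1] at hs
  rw [← Path.Homotopic.Quotient.mk_trans]
  exact (Path.Homotopic.Quotient.eq.2 hs).symm

end Simplex

/-! ### The loop `τ·ρ` of the proof of Theorem 4.3 -/

section Loop

/-- `Δ² A = Δ²A` with the integer power (the chain of `GompfFramedSpheres.lean` uses `ℕ`-powers). [cite: GompfAGT2010, Thm 4.3 (proof, the chain of four moves)] -/
theorem gompfDelta_zpow_two_mul_gompfFramingA :
    gompfDelta ^ (2 : ℤ) * gompfFramingA = gompfChainOne := by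
  rw [zpow_ofNat]; exact gompfDelta_sq_mul_gompfFramingA

/-- `(Δ² A) Δ₀² = Δ²AΔ₀²` with the integer power. [cite: GompfAGT2010, Thm 4.3 (proof, the chain of four moves)] -/
theorem gompfChainOne_mul_gompfDeltaZero_zpow_two :
    gompfChainOne * gompfDeltaZero ^ (2 : ℤ) = gompfChainTwo := by
  rw [zpow_ofNat]; exact gompfChainOne_mul_gompfDeltaZero_sq

/-- `(Δ² A Δ₀²) Δ² = A₀` with the integer power. [cite: GompfAGT2010, Thm 4.3 (proof, the chain of four moves)] -/
theorem gompfChainTwo_mul_gompfDelta_zpow_two :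
    gompfChainTwo * gompfDelta ^ (2 : ℤ) = akbulutKirbyMatrix := by
  rw [zpow_ofNat]; exact gompfChainTwo_mul_gompfDelta_sq

/-- `Δ² A₀ = B` with the integer power. [cite: GompfAGT2010, Thm 4.3 (proof, the chain of four moves)] -/
theorem gompfDelta_zpow_two_mul_akbulutKirbyMatrix :
    gompfDelta ^ (2 : ℤ) * akbulutKirbyMatrix = gompfFramingB := by
  rw [zpow_ofNat]; exact gompfDelta_sq_mul_akbulutKirbyMatrix

/-- Segment 1 of `τ`, `A → Δ² A`, lies in `GL⁺(3, ℝ)`. [cite: GompfAGT2010, Thm 4.3 (proof: τ, the concatenation of the linear paths between consecutive matrices)] -/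
theorem det_gompfSegment₁_pos :
    ∀ t ∈ I, 0 < ((1 - t) • (slPoint gompfFramingA).1 + t • (slPoint gompfChainOne).1).det := by
  rw [← gompfDelta_zpow_two_mul_gompfFramingA]; exact det_segment_gompfDelta_zpow_mul _ _

/-- Segment 2 of `τ`, `Δ² A → Δ² A Δ₀²`, lies in `GL⁺(3, ℝ)`. [cite: GompfAGT2010, Thm 4.3 (proof: τ, the concatenation of the linear paths between consecutive matrices)] -/
theorem det_gompfSegment₂_pos :
    ∀ t ∈ I, 0 < ((1 - t) • (slPoint gompfChainOne).1 + t • (slPoint gompfChainTwo).1).det := by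
  rw [← gompfChainOne_mul_gompfDeltaZero_zpow_two]; exact det_segment_mul_gompfDeltaZero_zpow _ _

/-- Segment 3 of `τ`, `Δ² A Δ₀² → A₀`, lies in `GL⁺(3, ℝ)`. [cite: GompfAGT2010, Thm 4.3 (proof: τ, the concatenation of the linear paths between consecutive matrices)] -/
theorem det_gompfSegment₃_pos :
    ∀ t ∈ I, 0 < ((1 - t) • (slPoint gompfChainTwo).1 + t • (slPoint akbulutKirbyMatrix).1).det := by
  rw [← gompfChainTwo_mul_gompfDelta_zpow_two]; exact det_segment_mul_gompfDelta_zpow _ _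

/-- Segment 4 of `τ`, `A₀ → B`, lies in `GL⁺(3, ℝ)`. [cite: GompfAGT2010, Thm 4.3 (proof: τ, the concatenation of the linear paths between consecutive matrices)] -/
theorem det_gompfSegment₄_pos :
    ∀ t ∈ I, 0 < ((1 - t) • (slPoint akbulutKirbyMatrix).1 + t • (slPoint gompfFramingB).1).det := by
  rw [← gompfDelta_zpow_two_mul_akbulutKirbyMatrix]; exact det_segment_gompfDelta_zpow_mul _ _

/-- Segment 1 of `τ` as a path: `A → Δ² A`. [cite: GompfAGT2010, Thm 4.3 (proof: τ, the concatenation of the linear paths between consecutive matrices)] -/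
def gompfSegment₁ : Path (slPoint gompfFramingA) (slPoint gompfChainOne) :=
  segmentPath _ _ det_gompfSegment₁_pos

/-- Segment 2 of `τ` as a path: `Δ² A → Δ² A Δ₀²`. [cite: GompfAGT2010, Thm 4.3 (proof: τ, the concatenation of the linear paths between consecutive matrices)] -/
def gompfSegment₂ : Path (slPoint gompfChainOne) (slPoint gompfChainTwo) :=
  segmentPath _ _ det_gompfSegment₂_pos

/-- Segment 3 of `τ` as a path: `Δ² A Δ₀² → A₀`. [cite: GompfAGT2010, Thm 4.3 (proof: τ, the concatenation of the linear paths between consecutive matrices)] -/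
def gompfSegment₃ : Path (slPoint gompfChainTwo) (slPoint akbulutKirbyMatrix) :=
  segmentPath _ _ det_gompfSegment₃_pos

/-- Segment 4 of `τ` as a path: `A₀ → B`. [cite: GompfAGT2010, Thm 4.3 (proof: τ, the concatenation of the linear paths between consecutive matrices)] -/
def gompfSegment₄ : Path (slPoint akbulutKirbyMatrix) (slPoint gompfFramingB) :=
  segmentPath _ _ det_gompfSegment₄_pos

/-- **Gompf's `τ`** (read from `A` to `B`): "the concatenation of the linear paths between
consecutive matrices" `A → Δ²A → Δ²AΔ₀² → A₀ → B` of the chain. [cite: GompfAGT2010, Thm 4.3 (proof: τ, the concatenation of the linear paths between consecutive matrices)] -/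
def gompfTau : Path (slPoint gompfFramingA) (slPoint gompfFramingB) :=
  ((gompfSegment₁.trans gompfSegment₂).trans gompfSegment₃).trans gompfSegment₄

/-- **Gompf's 1-cycle `τ·ρ`**: the loop at `A` "obtained by linearly connecting the above five
matrices into a 1-cycle in the given cyclic order", here `A → Δ²A → Δ²AΔ₀² → A₀ → B → A`. [cite: GompfAGT2010, Thm 4.3 (proof: the 1-cycle τ·ρ)] -/
def gompfFramingLoop : Path (slPoint gompfFramingA) (slPoint gompfFramingA) :=
  gompfTau.trans (segmentPath _ _ det_segment_gompfFraming_pos')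

/-- The closing segment of the loop is `ρ` reversed. [cite: GompfAGT2010, Thm 4.3 (proof: the 1-cycle τ·ρ)] -/
theorem gompfRho_symm : gompfRho.symm = segmentPath _ _ det_segment_gompfFraming_pos' :=
  segmentPath_symm _ _ _ _

end Loop

/-! ### The atomic leaves -/

section Facts

/-- **W — `X^σ_A` depends only on the straightening class.** Gompf 2010, Def. 4.1: "a
*straightening* of a linear transformation `A ∈ GL(V)` is a homotopy class of paths in `GL(V)`
from `A` to the identity `I`"; §4 ¶2: "the two straightenings `σ` of `d(φ₀)_p` canonically
determine the two possible isotopy classes (rel a neighborhood of `p`) of monodromies for the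
Cappell–Shaneson construction on `φ₀`, and hence the two resulting diffeomorphism types, which we
denote by `X^σ_{φ₀}`." Formal rendering on the tree's representatives: if two smooth framing paths
`γ, γ'` from `1` to `A` are homotopic rel end points as paths in `GL⁺(3, ℝ)` (`PosDetMatrix 3`),
the concrete spheres `gompfSphere A γ = (sectionCircleNbhd A γ).Surgered` and `gompfSphere A γ'`
are diffeomorphic. (Mechanism: a homotopy of framing paths is an isotopy of the tubes
`sectionCircleNbhd A γ ≃ sectionCircleNbhd A γ'` through tubular neighbourhoods of the section
circle — including the change of the auxiliary radius —, and surgery along isotopic framed tubes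
gives diffeomorphic manifolds, Gompf–Stipsicz §5.2.) Size: L (an explicit fibrewise
diffeomorphism of `CSTorus A` supported near the section circle, then gluing uniqueness). [cite: GompfAGT2010, Def. 4.1 and §4 ¶2 (X^σ depends only on the straightening class σ)] [cite: GompfStipsiczGSM1999, §5.2] -/
def gompf2010_straightening_invariance : Prop :=
  ∀ (A : Matrix.SpecialLinearGroup (Fin 3) ℤ) (γ γ' : SmoothMatrixPath (slRealMatrix A)),
    γ.toPath.Homotopic γ'.toPath → Nonempty (gompfSphere A γ ≃ₘ⟮𝓡 4, 𝓡 4⟯ gompfSphere A γ')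

/-- **Cj — conjugation invariance of `X^σ_A`.** Gompf 2010, §3 ¶1: the pair of Cappell–Shaneson
spheres of `A` "only depends on the conjugacy class of `A`"; proof of Thm 4.3: "`B = C A C⁻¹` …
Since conjugation preserves linear straightenings, we obtain a diffeomorphism from `X^{σ_A}_A` to
`X^{σ_B}_B`." Formal rendering: for `C ∈ SL(3, ℤ)` the sphere of `C A C⁻¹` framed by the conjugate
path `C γ C⁻¹` is diffeomorphic to the sphere of `A` framed by `γ`. (Mechanism: the linear
diffeomorphism `torusMap C × id` of the cylinders descends to `CSTorus A ≃ CSTorus (C A C⁻¹)`,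
mapping the section circle to the section circle and the tube framed by `γ` to the tube framed by
`C γ C⁻¹` precomposed with the linear change of fibre coordinates `C`; the latter does not change
the surgery up to diffeomorphism.) Size: L. [cite: GompfAGT2010, §3 ¶1 and Thm 4.3 (proof: conjugation preserves linear straightenings, X^{σ_A}_A ≅ X^{σ_B}_B)] -/
def gompf2010_conj_invariance : Prop :=
  ∀ (A C : Matrix.SpecialLinearGroup (Fin 3) ℤ) (γ : SmoothMatrixPath (slRealMatrix A)),
    Nonempty (gompfSphere (C * A * C⁻¹) (γ.conj C) ≃ₘ⟮𝓡 4, 𝓡 4⟯ gompfSphere A γ)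

/-- **F — the framed Theorem 2.1 for the Δ-moves** (Gompf 2010, §4 ¶3): "let `A` be a
Cappell–Shaneson matrix, and suppose `B` is obtained from `A` as in Theorem 2.1. That is, after a
change of basis, `B` is obtained from `A` by left- or right-multiplying it by a power `Δᵏ` of the
matrix `Δ` … Multiplying this by `A` gives the linear path `τ` from `B` to `A` … in fact
`X^{τ·σ}_B = X^σ_A` for each straightening `σ`." For `A` in standard form no change of basis is
needed (§3 ¶3: Theorem 2.1 applies "with a Dehn twist `δ` along the torus spanned by the first and
third coordinate axes … `δ` is isotopic to the linear diffeomorphism `Δ`"; it changes `A` "by adding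
any multiple of the second row to the third while subtracting the same multiple from the first,
or by the conjugate operation on the second column"). Formal rendering on the tree's concrete
spheres, with `τ·σ` read from `1` (`SmoothMatrixPath.deltaLeft/deltaRight`: the framing path `γ`
from `1` to `A` followed by the straight segment from `A` to `Δᵏ A`, resp. `A Δᵏ`): for `A` in
standard form with `det (A - 1) = 1`, every `γ` and every `k ∈ ℤ`,
`gompfSphere A γ ≅ gompfSphere (Δᵏ A) (γ.deltaLeft k)` and
`gompfSphere A γ ≅ gompfSphere (A Δᵏ) (γ.deltaRight k)`. Convention check: the tree glues
`(x, s) ∼ (A x, s + 1)` (Gompf's `X_{A⁻¹}`; Theorem 2.1 for `A⁻¹` with `α` the third coordinate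
circle yields both `Δᵏ A` and `A Δᵏ`), and the diffeomorphism of Theorem 2.1 followed by the
linear isotopy from `δᵏ` to `Δᵏ` (`Δ - I` has square zero, so `(1 - t) I + t Δᵏ` is that isotopy
at the tangent space of the base point) carries the tube framed by `γ` to the tube framed by `γ`
followed by the segment from `A` to `B`. Size: XL (Theorem 2.1 proper: fishtail neighbourhoods and
Lemma 2.2). [cite: GompfAGT2010, §4 ¶3 (X^{τ·σ}_B = X^σ_A for B = Δᵏ A or A Δᵏ) and Thm 2.1, §3 ¶3] -/
def gompf2010_framedTwist : Prop :=
  ∀ (A : Matrix.SpecialLinearGroup (Fin 3) ℤ), IsGompfStandardForm A →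
    ((A : Matrix (Fin 3) (Fin 3) ℤ) - 1).det = 1 →
    ∀ (γ : SmoothMatrixPath (slRealMatrix A)) (k : ℤ),
      Nonempty (gompfSphere A γ ≃ₘ⟮𝓡 4, 𝓡 4⟯ gompfSphere (gompfDelta ^ k * A) (γ.deltaLeft k)) ∧
      Nonempty (gompfSphere A γ ≃ₘ⟮𝓡 4, 𝓡 4⟯ gompfSphere (A * gompfDelta ^ k) (γ.deltaRight k))

/-- **F₀ — the framed Theorem 2.1 for the Δ₀-moves** (Gompf 2010, §4 ¶5): "Suppose the
Cappell–Shaneson matrix `A` has second column given by `[1 -1 0]ᵀ`. Then the second basis vector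
`e₂` and `A e₂` span the integer lattice in the plane perpendicular to the third axis. Thus,
Theorem 2.1 gives us a diffeomorphism `δ₀` that is a Dehn twist along a torus perpendicular the
third axis, in the direction of `A e₂ - e₂ = [1 -2 0]ᵀ`. The corresponding linear diffeomorphism
is `Δ₀ = !![1, 0, 1; 0, 1, -2; 0, 0, 1]`. In particular, when `A` has the required second column,
we have `X^{τ·σ}_B = X^σ_A`, where `B` is obtained from `A` by multiplying by some `Δ₀ᵏ` on the
left or right, `τ` is the linear path from `B` to `A`, and `σ` is either straightening." Formal
rendering as for `gompf2010_framedTwist`, with `SmoothMatrixPath.deltaZeroLeft/deltaZeroRight`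
(hypotheses: second column `(1, -1, 0)ᵀ` and `det (A - 1) = 1`). Size: XL (Theorem 2.1 proper). [cite: GompfAGT2010, §4 ¶5 (X^{τ·σ}_B = X^σ_A for B = Δ₀ᵏ A or A Δ₀ᵏ) and Thm 2.1] -/
def gompf2010_framedTwistZero : Prop :=
  ∀ (A : Matrix.SpecialLinearGroup (Fin 3) ℤ),
    (A : Matrix (Fin 3) (Fin 3) ℤ) 0 1 = 1 → (A : Matrix (Fin 3) (Fin 3) ℤ) 1 1 = -1 →
    (A : Matrix (Fin 3) (Fin 3) ℤ) 2 1 = 0 → ((A : Matrix (Fin 3) (Fin 3) ℤ) - 1).det = 1 →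
    ∀ (γ : SmoothMatrixPath (slRealMatrix A)) (k : ℤ),
      Nonempty (gompfSphere A γ ≃ₘ⟮𝓡 4, 𝓡 4⟯
        gompfSphere (gompfDeltaZero ^ k * A) (γ.deltaZeroLeft k)) ∧
      Nonempty (gompfSphere A γ ≃ₘ⟮𝓡 4, 𝓡 4⟯
        gompfSphere (A * gompfDeltaZero ^ k) (γ.deltaZeroRight k))

/-- **P1 — `π₁(GL⁺(3, ℝ)) ≅ ℤ/2`.** Gompf 2010, §4, after Def. 4.1: "When `det(A) > 0` there are
exactly two straightenings of `A`, differing by an element of `π₁(GL(V)) = ℤ/2`"; proof of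
Thm 4.3: "`H₁(GL⁺(3, ℝ)) = π₁(GL(3, ℝ)) = ℤ/2`" (the identity component `GL⁺(3, ℝ)` deformation
retracts onto `SO(3)` by the Gram–Schmidt procedure, loc. cit.; Hatcher, *Algebraic Topology*,
§3.D: "the Gram–Schmidt orthogonalization process … provides a retraction `r : GLₙ(ℝ) → O(n)` …
`O(n)` is in fact a deformation retract of `GLₙ(ℝ)`", "`SO(3)` is homeomorphic to `ℝP³`", and
Example 1.43: "`π₁(ℝPⁿ) ≈ ℤ₂` for `n ≥ 2`"). Formal rendering: the fundamental group of
`PosDetMatrix 3 = GL⁺(3, ℝ)` (the identity component of `GL₃(ℝ)`, retracting onto `SO(3)`) at `1`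
has exactly two elements (a group of order two is `ℤ/2`). Size: L–XL (`SO(3) ← S³` double cover,
simple connectivity of `S³`, path lifting, the Gram–Schmidt retraction; not assembled in
Mathlib). [cite: GompfAGT2010, §4 (after Def. 4.1: π₁(GL(V)) = ℤ/2; proof of Thm 4.3: π₁(GL(3, ℝ)) = ℤ/2 via Gram–Schmidt onto SO(3))] [cite: HatcherAT2002, §3.D (GLₙ(ℝ) deformation retracts onto O(n); SO(3) ≈ ℝP³) and Example 1.43 (π₁(ℝPⁿ) = ℤ₂)] -/
def fundamentalGroup_posDetMatrix_three : Prop :=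
  Nat.card (FundamentalGroup (PosDetMatrix 3) 1) = 2

/-- **P2 — Gompf's loop `τ·ρ` is essential.** Proof of Thm 4.3, last paragraph: "it suffices to
show that the 1-cycle `τ·σ_A·σ_B⁻¹` … is nontrivial in `H₁(GL⁺(3, ℝ)) = π₁(GL(3, ℝ)) = ℤ/2` …
the desired 1-cycle … is homologous in `GL⁺(3, ℝ)` to `τ·ρ`, which is obtained by linearly
connecting the above five matrices into a 1-cycle in the given cyclic order. To compute its
homology class, we deformation retract `GL⁺(3, ℝ) → SO(3)` by the Gram–Schmidt procedure. Each
matrix in `τ·ρ` has first column `[0 0 1]ᵀ` … The second column `[a c e]ᵀ` becomes `[a c 0]ᵀ` up to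
positive scale … It now suffices to compute the mod `2` winding number of `(a, c)` in `ℝ²`, but
this is nonzero by inspection." Formal rendering (the homotopy-level consequence of the printed
homology statement): the loop `gompfFramingLoop` at `A` through `A, Δ²A, Δ²AΔ₀², A₀, B, A` by
straight segments is not null-homotopic rel base point in `GL⁺(3, ℝ)`. Size: L–XL (needs a
`ℤ/2`-valued homotopy invariant of loops in `GL⁺(3, ℝ)`, i.e. the spin double cover). [cite: GompfAGT2010, Thm 4.3 (proof, last paragraph: the 1-cycle τ·ρ is nontrivial, "nonzero by inspection")] -/
def gompf2010_framingLoop_essential : Prop :=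
  ¬ gompfFramingLoop.Homotopic (Path.refl _)

end Facts

/-! ### Consequences: `[σ_B] ≠ [τ·σ_A]`, the pigeonhole, Theorem 4.3 -/

section Consequences

/-- Left cancellation in the fundamental groupoid. [folklore] -/
theorem quotient_trans_left_cancel {X : Type*} [TopologicalSpace X] {x y z : X}
    (p : Path.Homotopic.Quotient x y) {q r : Path.Homotopic.Quotient y z}
    (h : p.trans q = p.trans r) : q = r := by
  have h' := congrArg (Path.Homotopic.Quotient.trans p.symm) h
  rw [← Path.Homotopic.Quotient.trans_assoc, ← Path.Homotopic.Quotient.trans_assoc,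
    Path.Homotopic.Quotient.symm_trans, Path.Homotopic.Quotient.refl_trans,
    Path.Homotopic.Quotient.refl_trans] at h'
  exact h'

/-- Right cancellation against an inverse in the fundamental groupoid:
`p · r⁻¹ = refl → p = r`. [folklore] -/
theorem quotient_eq_of_trans_symm_eq_refl {X : Type*} [TopologicalSpace X] {x y : X}
    {p r : Path.Homotopic.Quotient x y} (h : p.trans r.symm = Path.Homotopic.Quotient.refl x) :
    p = r := by
  have h' := congrArg (fun q ↦ Path.Homotopic.Quotient.trans q r) h
  simp only [Path.Homotopic.Quotient.trans_assoc, Path.Homotopic.Quotient.symm_trans,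
    Path.Homotopic.Quotient.trans_refl, Path.Homotopic.Quotient.refl_trans] at h'
  exact h'

/-- **The pigeonhole from `π₁ = ℤ/2`**: if the fundamental group at `x` has two elements and
`p ≠ q` are classes of paths from `x` to `y`, every class `r` from `x` to `y` equals `p` or `q`. [cite: GompfAGT2010, §4 (after Def. 4.1: exactly two straightenings, differing by an element of π₁(GL(V)) = ℤ/2)] -/
theorem quotient_eq_or_eq_of_card_eq_two {X : Type*} [TopologicalSpace X] {x y : X}
    (hcard : Nat.card (FundamentalGroup X x) = 2) {p q : Path.Homotopic.Quotient x y}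
    (hpq : p ≠ q) (r : Path.Homotopic.Quotient x y) : r = p ∨ r = q := by
  -- the loops `u = p · r⁻¹` and `v = q · r⁻¹` are distinct, so one of them is trivial
  let u : FundamentalGroup X x := FundamentalGroup.fromPath (p.trans r.symm)
  let v : FundamentalGroup X x := FundamentalGroup.fromPath (q.trans r.symm)
  have hu : FundamentalGroup.toPath u = p.trans r.symm := rfl
  have hv : FundamentalGroup.toPath v = q.trans r.symm := rfl
  have huv : u ≠ v := by
    intro huv
    apply hpq
    have h' : p.trans r.symm = q.trans r.symm := by rw [← hu, ← hv, huv]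
    have h'' := congrArg (fun s ↦ Path.Homotopic.Quotient.trans s r) h'
    simp only [Path.Homotopic.Quotient.trans_assoc, Path.Homotopic.Quotient.symm_trans,
      Path.Homotopic.Quotient.trans_refl] at h''
    exact h''
  obtain ⟨w, -, hw⟩ := (Nat.card_eq_two_iff' u).1 hcard
  by_cases hu1 : u = 1
  · left
    have : p.trans r.symm = Path.Homotopic.Quotient.refl x := by
      rw [← hu, hu1, FundamentalGroup.one_def]
    exact (quotient_eq_of_trans_symm_eq_refl this).symm
  · right
    have hv' : v = w := hw v huv.symm
    have h1' : (1 : FundamentalGroup X x) = w := hw 1 (Ne.symm hu1)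
    have : q.trans r.symm = Path.Homotopic.Quotient.refl x := by
      rw [← hv, hv', ← h1', FundamentalGroup.one_def]
    exact (quotient_eq_of_trans_symm_eq_refl this).symm

/-- **Given the 2-simplex, `[σ_B] ≠ [τ·σ_A]` follows from the essentiality of `τ·ρ`**: if the
linear straightening of `B` were homotopic to `σ_A` followed by `τ`, then `[ρ] = [τ]` and the loop
`τ·ρ⁻¹` would be null-homotopic. [cite: GompfAGT2010, Thm 4.3 (proof, last paragraph: τ·σ_A·σ_B⁻¹ is homologous to τ·ρ, which is nontrivial)] -/
theorem mk_toPath_gompfSigmaB_ne (hL : gompf2010_framingLoop_essential) :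
    Path.Homotopic.Quotient.mk gompfSigmaB.toPath ≠
      (Path.Homotopic.Quotient.mk gompfSigmaA.toPath).trans (Path.Homotopic.Quotient.mk gompfTau) := by
  intro h
  rw [mk_toPath_gompfSigmaB] at h
  have hρτ : Path.Homotopic.Quotient.mk gompfRho = Path.Homotopic.Quotient.mk gompfTau :=
    quotient_trans_left_cancel _ h
  apply hL
  rw [← Path.Homotopic.Quotient.eq, Path.Homotopic.Quotient.mk_refl]
  show Path.Homotopic.Quotient.mk (gompfTau.trans (segmentPath _ _ det_segment_gompfFraming_pos')) = _
  rw [← gompfRho_symm, Path.Homotopic.Quotient.mk_trans, Path.Homotopic.Quotient.mk_symm, ← hρτ,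
    Path.Homotopic.Quotient.trans_symm]

/-- `gompfFramingA` is in standard form. [cite: GompfAGT2010, Thm 4.3 (proof, the matrix A)] -/
theorem isGompfStandardForm_gompfFramingA : IsGompfStandardForm gompfFramingA := by
  simp [IsGompfStandardForm]

/-- `gompfChainTwo` is in standard form. [cite: GompfAGT2010, Thm 4.3 (proof, the chain of four moves)] -/
theorem isGompfStandardForm_gompfChainTwo : IsGompfStandardForm gompfChainTwo := by
  simp [IsGompfStandardForm]

/-- `det (Δ²A - 1) = 1`. [cite: GompfAGT2010, Thm 4.3 (proof, the chain of four moves)] -/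
theorem det_gompfChainOne_sub_one : ((gompfChainOne : Matrix (Fin 3) (Fin 3) ℤ) - 1).det = 1 := by
  decide

/-- `det (Δ²AΔ₀² - 1) = 1`. [cite: GompfAGT2010, Thm 4.3 (proof, the chain of four moves)] -/
theorem det_gompfChainTwo_sub_one : ((gompfChainTwo : Matrix (Fin 3) (Fin 3) ℤ) - 1).det = 1 := by
  decide

/-- Composition of diffeomorphisms at the level of `Nonempty` (instance arguments taken from the
hypotheses, so that no instance search on the glued manifolds is repeated). [folklore] -/
theorem nonempty_diffeomorph_trans {M N P : Type*} {_ : TopologicalSpace M}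
    {_ : ChartedSpace (EuclideanSpace ℝ (Fin 4)) M} {_ : TopologicalSpace N}
    {_ : ChartedSpace (EuclideanSpace ℝ (Fin 4)) N} {_ : TopologicalSpace P}
    {_ : ChartedSpace (EuclideanSpace ℝ (Fin 4)) P}
    (h₁ : Nonempty (M ≃ₘ⟮𝓡 4, 𝓡 4⟯ N)) (h₂ : Nonempty (N ≃ₘ⟮𝓡 4, 𝓡 4⟯ P)) :
    Nonempty (M ≃ₘ⟮𝓡 4, 𝓡 4⟯ P) :=
  let ⟨e₁⟩ := h₁; let ⟨e₂⟩ := h₂; ⟨e₁.trans e₂⟩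

/-- **Move 1 of the chain, framed**: left multiplication by `Δ²`, `X^γ_A ≅ X^{γ₁}_{Δ²A}` with
`[γ₁] = [γ] · [segment 1]`. [cite: GompfAGT2010, Thm 4.3 (proof: the four moves, each from Theorem 2.1)] -/
theorem gompf_chain_framed₁ (hF : gompf2010_framedTwist)
    (γ : SmoothMatrixPath (slRealMatrix gompfFramingA)) :
    ∃ γ₁ : SmoothMatrixPath (slRealMatrix gompfChainOne),
      Nonempty (gompfSphere gompfFramingA γ ≃ₘ⟮𝓡 4, 𝓡 4⟯ gompfSphere gompfChainOne γ₁) ∧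
      Path.Homotopic.Quotient.mk γ₁.toPath =
        (Path.Homotopic.Quotient.mk γ.toPath).trans (Path.Homotopic.Quotient.mk gompfSegment₁) :=
  ⟨_, nonempty_diffeomorph_trans
      (hF gompfFramingA isGompfStandardForm_gompfFramingA det_gompfFramingA_sub_one γ 2).1
      (nonempty_diffeomorph_gompfSphere_along (γ.deltaLeft 2) gompfDelta_zpow_two_mul_gompfFramingA),
    γ.mk_toPath_deltaLeft 2 _ det_gompfSegment₁_pos⟩

/-- **Move 2 of the chain, framed**: right multiplication by `Δ₀²` (the second column of `Δ²A` is
`(1, -1, 0)ᵀ`), `X^{γ₁}_{Δ²A} ≅ X^{γ₂}_{Δ²AΔ₀²}` with `[γ₂] = [γ₁] · [segment 2]`. [cite: GompfAGT2010, Thm 4.3 (proof: the four moves, each from Theorem 2.1)] -/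
theorem gompf_chain_framed₂ (hF₀ : gompf2010_framedTwistZero)
    (γ₁ : SmoothMatrixPath (slRealMatrix gompfChainOne)) :
    ∃ γ₂ : SmoothMatrixPath (slRealMatrix gompfChainTwo),
      Nonempty (gompfSphere gompfChainOne γ₁ ≃ₘ⟮𝓡 4, 𝓡 4⟯ gompfSphere gompfChainTwo γ₂) ∧
      Path.Homotopic.Quotient.mk γ₂.toPath =
        (Path.Homotopic.Quotient.mk γ₁.toPath).trans (Path.Homotopic.Quotient.mk gompfSegment₂) :=
  ⟨_, nonempty_diffeomorph_trans
      (hF₀ gompfChainOne (by decide) (by decide) (by decide) det_gompfChainOne_sub_one γ₁ 2).2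
      (nonempty_diffeomorph_gompfSphere_along (γ₁.deltaZeroRight 2)
        gompfChainOne_mul_gompfDeltaZero_zpow_two),
    γ₁.mk_toPath_deltaZeroRight 2 _ det_gompfSegment₂_pos⟩

/-- **Move 3 of the chain, framed**: right multiplication by `Δ²`, `X^{γ₂}_{Δ²AΔ₀²} ≅ X^{γ₃}_{A₀}`
with `[γ₃] = [γ₂] · [segment 3]`. [cite: GompfAGT2010, Thm 4.3 (proof: the four moves, each from Theorem 2.1)] -/
theorem gompf_chain_framed₃ (hF : gompf2010_framedTwist)
    (γ₂ : SmoothMatrixPath (slRealMatrix gompfChainTwo)) :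
    ∃ γ₃ : SmoothMatrixPath (slRealMatrix akbulutKirbyMatrix),
      Nonempty (gompfSphere gompfChainTwo γ₂ ≃ₘ⟮𝓡 4, 𝓡 4⟯ gompfSphere akbulutKirbyMatrix γ₃) ∧
      Path.Homotopic.Quotient.mk γ₃.toPath =
        (Path.Homotopic.Quotient.mk γ₂.toPath).trans (Path.Homotopic.Quotient.mk gompfSegment₃) :=
  ⟨_, nonempty_diffeomorph_trans
      (hF gompfChainTwo isGompfStandardForm_gompfChainTwo det_gompfChainTwo_sub_one γ₂ 2).2
      (nonempty_diffeomorph_gompfSphere_along (γ₂.deltaRight 2) gompfChainTwo_mul_gompfDelta_zpow_two),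
    γ₂.mk_toPath_deltaRight 2 _ det_gompfSegment₃_pos⟩

/-- **Move 4 of the chain, framed**: left multiplication by `Δ²`, `X^{γ₃}_{A₀} ≅ X^{γ₄}_B` with
`[γ₄] = [γ₃] · [segment 4]`. [cite: GompfAGT2010, Thm 4.3 (proof: the four moves, each from Theorem 2.1)] -/
theorem gompf_chain_framed₄ (hF : gompf2010_framedTwist)
    (γ₃ : SmoothMatrixPath (slRealMatrix akbulutKirbyMatrix)) :
    ∃ γ₄ : SmoothMatrixPath (slRealMatrix gompfFramingB),
      Nonempty (gompfSphere akbulutKirbyMatrix γ₃ ≃ₘ⟮𝓡 4, 𝓡 4⟯ gompfSphere gompfFramingB γ₄) ∧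
      Path.Homotopic.Quotient.mk γ₄.toPath =
        (Path.Homotopic.Quotient.mk γ₃.toPath).trans (Path.Homotopic.Quotient.mk gompfSegment₄) :=
  ⟨_, nonempty_diffeomorph_trans
      (hF akbulutKirbyMatrix isGompfStandardForm_akbulutKirbyMatrix det_akbulutKirbyMatrix_sub_one γ₃ 2).1
      (nonempty_diffeomorph_gompfSphere_along (γ₃.deltaLeft 2)
        gompfDelta_zpow_two_mul_akbulutKirbyMatrix),
    γ₃.mk_toPath_deltaLeft 2 _ det_gompfSegment₄_pos⟩

/-- **The chain of four framed moves**: for every straightening `γ` of `A`,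
`X^γ_A ≅ X^{γ₄}_B` where `γ₄` is `γ` followed by `τ` (transported along the four matrix
identities of the chain), and `[γ₄] = [γ] · [τ]` ("our previous discussion gives a diffeomorphism
from `X^σ_A` to `X^{τ·σ}_B` for each straightening `σ` of `A`, where `τ` is the concatenation of
the linear paths between consecutive matrices above"). [cite: GompfAGT2010, Thm 4.3 (proof: a diffeomorphism from X^σ_A to X^{τ·σ}_B for each straightening σ of A)] -/
theorem gompf_chain_framed (hF : gompf2010_framedTwist) (hF₀ : gompf2010_framedTwistZero)
    (γ : SmoothMatrixPath (slRealMatrix gompfFramingA)) :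
    ∃ γ₄ : SmoothMatrixPath (slRealMatrix gompfFramingB),
      Nonempty (gompfSphere gompfFramingA γ ≃ₘ⟮𝓡 4, 𝓡 4⟯ gompfSphere gompfFramingB γ₄) ∧
      Path.Homotopic.Quotient.mk γ₄.toPath =
        (Path.Homotopic.Quotient.mk γ.toPath).trans (Path.Homotopic.Quotient.mk gompfTau) := by
  obtain ⟨γ₁, h₁, q₁⟩ := gompf_chain_framed₁ hF γ
  obtain ⟨γ₂, h₂, q₂⟩ := gompf_chain_framed₂ hF₀ γ₁
  obtain ⟨γ₃, h₃, q₃⟩ := gompf_chain_framed₃ hF γ₂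
  obtain ⟨γ₄, h₄, q₄⟩ := gompf_chain_framed₄ hF γ₃
  refine ⟨γ₄, nonempty_diffeomorph_trans h₁ (nonempty_diffeomorph_trans h₂
    (nonempty_diffeomorph_trans h₃ h₄)), ?_⟩
  rw [q₄, q₃, q₂, q₁, gompfTau]
  simp only [Path.Homotopic.Quotient.mk_trans, Path.Homotopic.Quotient.trans_assoc]

/-- **"Since conjugation preserves linear straightenings, we obtain a diffeomorphism from
`X^{σ_A}_A` to `X^{σ_B}_B`."** [cite: GompfAGT2010, Thm 4.3 (proof: conjugation preserves linear straightenings, X^{σ_A}_A ≅ X^{σ_B}_B)] -/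
theorem nonempty_diffeomorph_gompfSphere_gompfSigmaA_gompfSigmaB
    (hW : gompf2010_straightening_invariance) (hC : gompf2010_conj_invariance) :
    Nonempty (gompfSphere gompfFramingA gompfSigmaA ≃ₘ⟮𝓡 4, 𝓡 4⟯ gompfSphere gompfFramingB gompfSigmaB) := by
  obtain ⟨e₁⟩ := hC gompfFramingA gompfFramingC gompfSigmaA
  obtain ⟨e₂⟩ := nonempty_diffeomorph_gompfSphere_along (gompfSigmaA.conj gompfFramingC)
    gompfFramingB_eq_conj.symm
  have hpath : ((gompfSigmaA.conj gompfFramingC).along gompfFramingB_eq_conj.symm).toPath =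
      gompfSigmaB.toPath := by
    refine Path.ext (funext fun t ↦ Subtype.ext ?_)
    show slRealMatrix gompfFramingC * linearPath (slRealMatrix gompfFramingA) (Real.smoothTransition t) *
        slRealMatrix gompfFramingC⁻¹ = linearPath (slRealMatrix gompfFramingB) (Real.smoothTransition t)
    rw [← linearPath_conj _ _ _ (slRealMatrix_mul_inv gompfFramingC), ← slRealMatrix_mul,
      ← slRealMatrix_mul, ← gompfFramingB_eq_conj]
  have hhom : ((gompfSigmaA.conj gompfFramingC).along gompfFramingB_eq_conj.symm).toPath.Homotopic
      gompfSigmaB.toPath := by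
    rw [hpath]
  exact nonempty_diffeomorph_trans ⟨e₁.symm⟩ (nonempty_diffeomorph_trans ⟨e₂⟩ (hW gompfFramingB _ _ hhom))

/-- **Every straightening of `B` gives the same sphere**: by the chain, conjugation and the
2-simplex, `X^{σ_B}_B ≅ X^{σ_A}_A ≅ X^{τ·σ_A}_B` with `[σ_B] ≠ [τ·σ_A]`; by `π₁ = ℤ/2` any
straightening of `B` is one of these two classes. [cite: GompfAGT2010, Thm 4.3 (proof)] -/
theorem nonempty_diffeomorph_gompfSphere_gompfFramingB (hW : gompf2010_straightening_invariance)
    (hC : gompf2010_conj_invariance) (hF : gompf2010_framedTwist) (hF₀ : gompf2010_framedTwistZero)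
    (hπ : fundamentalGroup_posDetMatrix_three) (hL : gompf2010_framingLoop_essential)
    (δ : SmoothMatrixPath (slRealMatrix gompfFramingB)) :
    Nonempty (gompfSphere gompfFramingB δ ≃ₘ⟮𝓡 4, 𝓡 4⟯ gompfSphere gompfFramingB gompfSigmaB) := by
  obtain ⟨γ₄, ⟨e₄⟩, q₄⟩ := gompf_chain_framed hF hF₀ gompfSigmaA
  have hne : Path.Homotopic.Quotient.mk gompfSigmaB.toPath ≠ Path.Homotopic.Quotient.mk γ₄.toPath :=
    fun h ↦ mk_toPath_gompfSigmaB_ne hL (h.trans q₄)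
  rcases quotient_eq_or_eq_of_card_eq_two hπ hne (Path.Homotopic.Quotient.mk δ.toPath) with h | h
  · exact hW gompfFramingB δ gompfSigmaB (Path.Homotopic.Quotient.eq.1 h)
  · exact nonempty_diffeomorph_trans (hW gompfFramingB δ γ₄ (Path.Homotopic.Quotient.eq.1 h))
      (nonempty_diffeomorph_trans ⟨e₄.symm⟩
        (nonempty_diffeomorph_gompfSphere_gompfSigmaA_gompfSigmaB hW hC))

/-- **Gompf 2010, Theorem 4.3, from the atomic leaves**: any two framed Cappell–Shaneson spheres
`gompfSphere A₀ γ`, `gompfSphere A₀ γ'` of the Akbulut–Kirby matrix are diffeomorphic — move both to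
`B = Δ² A₀` by the framed row move and compare there. [cite: GompfAGT2010, Thm 4.3] -/
theorem gompf2010_thm43_of_framed (hW : gompf2010_straightening_invariance)
    (hC : gompf2010_conj_invariance) (hF : gompf2010_framedTwist) (hF₀ : gompf2010_framedTwistZero)
    (hπ : fundamentalGroup_posDetMatrix_three) (hL : gompf2010_framingLoop_essential) :
    gompf2010_thm43 := by
  intro γ γ'
  have move : ∀ δ : SmoothMatrixPath (slRealMatrix akbulutKirbyMatrix),
      Nonempty (gompfSphere akbulutKirbyMatrix δ ≃ₘ⟮𝓡 4, 𝓡 4⟯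
        gompfSphere gompfFramingB gompfSigmaB) := fun δ ↦ by
    obtain ⟨δ₄, h₄, -⟩ := gompf_chain_framed₄ hF δ
    exact nonempty_diffeomorph_trans h₄
      (nonempty_diffeomorph_gompfSphere_gompfFramingB hW hC hF hF₀ hπ hL δ₄)
  obtain ⟨e'⟩ := move γ'
  exact nonempty_diffeomorph_trans (move γ) ⟨e'.symm⟩

/-- **The Δ-move leaf from the framed twist**: every Cappell–Shaneson sphere `X` of a standard-form
`A` is some `X^σ_A = gompfSphere A γ` (`gompf2010_straightening_classification`), which is
diffeomorphic to `gompfSphere (Δᵏ A) (γ.deltaLeft k)`, a Cappell–Shaneson sphere of `Δᵏ A`. [cite: GompfAGT2010, Thm 2.1 and §3 (Δ-moves on matrices in standard form)] -/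
theorem gompf2010_deltaMove_of_framedTwist (hF : gompf2010_framedTwist)
    (hW : gompf2010_straightening_classification.{u}) : gompf2010_deltaMove.{u} := by
  intro A hA hdet k X _ _ _ _ _ _ hX
  obtain ⟨γ, h⟩ := hW A X hX
  refine ⟨gompfSphere (gompfDelta ^ k * A) (γ.deltaLeft k), inferInstance, inferInstance,
    inferInstance, inferInstance, inferInstance, inferInstance,
    isCappellShanesonSphereOf_gompfSphere _ _ (Or.inl ?_),
    nonempty_diffeomorph_trans h (hF A hA hdet γ k).1⟩
  rw [hA.det_gompfDelta_zpow_mul_sub_one]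
  exact hdet

end Consequences

end Literature.Topology.FourManifolds

/-! ### Assembly -/

namespace Literature.Topology.FourManifolds

universe u

/-- Local notation: `𝔼 n` is the model Euclidean space `EuclideanSpace ℝ (Fin n)`. -/
local notation "𝔼 " n:arg => EuclideanSpace ℝ (Fin n)

variable (X : Type u) [TopologicalSpace X] [T2Space X] [SecondCountableTopology X]
  [ChartedSpace (𝔼 4) X] [IsManifold (𝓡 4) ∞ X] [CompactSpace X]

/-- **The current leaf set (atomic form).**
`nonempty_diffeomorph_sphere_four_of_isCappellShanesonSphereOf X` — every Cappell–Shaneson sphere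
`X` of any `Aₘ` is diffeomorphic to `S⁴` (Gompf 2010, Examples 3.1(a)) — from: the framings of the
section circle (`gompf2010_sectionCircle_framings`, at the universe of `X` and at `Type`, where the
Δ-moved spheres live), the straightening-class invariance **W**, conjugation invariance **Cj**,
the framed Theorem 2.1 **F**/**F₀**, `π₁ GL⁺(3, ℝ) = ℤ/2` **P1**, the essential loop **P2**, and
[AK1] (`akbulutKirby1979_linearStraightening`). [cite: GompfAGT2010, Examples 3.1(a)] -/
theorem nonempty_diffeomorph_sphere_four_of_isCappellShanesonSphereOf_of_atomic
    (hS : gompf2010_sectionCircle_framings.{u}) (hS₀ : gompf2010_sectionCircle_framings.{0})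
    (hW : gompf2010_straightening_invariance) (hC : gompf2010_conj_invariance)
    (hF : gompf2010_framedTwist) (hF₀ : gompf2010_framedTwistZero)
    (hπ : fundamentalGroup_posDetMatrix_three) (hL : gompf2010_framingLoop_essential)
    (hAK : akbulutKirby1979_linearStraightening) :
    nonempty_diffeomorph_sphere_four_of_isCappellShanesonSphereOf X :=
  nonempty_diffeomorph_sphere_four_of_isCappellShanesonSphereOf_of_sectionCircle X
    (gompf2010_deltaMove_of_framedTwist hF (gompf2010_straightening_classification_of_sectionCircle hS))
    hS₀ (gompf2010_thm43_of_framed hW hC hF hF₀ hπ hL) hAK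

end Literature.Topology.FourManifolds
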